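import Mathlib

/-!
# Gawędzki–Kupiainen 1985, Appendix 2: the periodic Gleason lemma (Fourier-coefficient form)

**Citation header (reproduction of PUBLISHED work; literature file of the Balaban lattice Yang–Mills cell
`pub-balaban`, seat b03 (B12 lineage), node `GK-A2-GLEASON-KERNEL`; requested by the β sub-cell literature seat
LIT2 (CITED-FACTS S-lit2g4-1, TRANSFER.md §9.1) and by the B12 §5 transcript (GAPS C-B12s-5: Bałaban CMP **109**
(1987) p. 294, "We obtain such a representation using some simple expansion connected with the Laurent series
expansion. It was used already in [43] for a similar purpose", [43] = the paper below).  Companion of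
`GawedzkiKupiainen1985.LLargeDominance` / `.BubbleLogLowerBound` (Appendix 1); independent of them (imports
Mathlib only).**
K. Gawędzki, A. Kupiainen, *Massless lattice φ⁴₄ theory: rigorous control of a renormalizable asymptotically
free model*, Commun. Math. Phys. **99** (1985) 197–252 [GawedzkiKupiainenMasslessLattice1985], Appendix 2,
pp. 248–250, read on the rendered journal pages (`HOME/b2b-balaban-beta-lit2/g4/renders/gk99/gk1985-cmp99-p052…p054-x2.png`).
p. 248: "Equations (11.8)–(11.10) are corollaries of the following result giving a solution to the Gleason
problem [36].  **Lemma.** *Let `f(p₁, …, p_d)` be a function analytic for `|Im p_j| < a`, periodic in each `p_μ`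
with period `2π` such that `∂^l f(0)/∂p_{μ₁}…∂p_{μ_l} = 0` for `l = 0, 1, …, k − 1`.  Then there exist functions
`f_{μ₁…μ_k}(p)` with the same analyticity and periodicity properties satisfying
`f(p) = Σ_{μ₁,…,μ_k} Π_{j=1}^{k} (e^{−ip_{μ_j}} − 1) f_{μ₁…μ_k}(p)`.*  `f_{μ₁…μ_k}` can be taken linearly depending on
`f` and such that for each `0 < a₁ < a₂ < a`,  `sup_{|Im p_μ| ≤ a₁} |f_{μ₁…μ_k}(p)| ≤ C(d, k, a₁, a₂) sup_{|Im p_μ| ≤ a₂} |f(p)|`"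
(the last display is the one p. 250 calls (4)).  Printed proof, pp. 249–250: (5) `f̃(e^{−ip₁}, …, e^{−ip_d}) ≡ f(p₁, …, p_d)`,
"`f̃(z₁, …, z_d)` analytic for `e^{−a} < |z_j| < e^{a}`"; (6) the vanishing derivatives at `z = (1, …, 1)`; (7)–(8) the Cauchy
formula on the poly-annulus, split over the `2^d` sign patterns `σ`; (9) Cauchy estimates; (10)–(11) Taylor expansion in
`v_μ − 1` with integral remainder; (12) the expansion of `(−z_μ)^{−1}`; (13) regrouping; (14)
"`f̃(z) = Σ_{μ₁,…,μ_k} f̃_{μ₁…μ_k}(z) Π_{j=1}^{k} (z_{μ_j} − 1)` … This completes the proof of Lemma."; (15)–(17) the application with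
`k = 2` to (11.6)–(11.10).

**What is reproduced (everything PROVED; `import Mathlib` only; no named facts, no `sorry`).**  The Lemma in the
form in which both G–K (11.8)–(11.10) and Bałaban CMP 109 §5 ((5.10) ⇒ (5.37)/(5.38)/(5.44)) USE it, namely on the
FOURIER-COEFFICIENT (position-space kernel) side: `f(p) = Σ_{n ∈ ℤ^d} c(n) e^{−ip·n}`, i.e. `f̃(z) = Σ_n c(n) zⁿ`, with
`|c(n)| ≤ M e^{−a|n|₁}` (`ExpBound a M c`) — the coefficient-side expression of "analytic and bounded on the tube
`|Im p_μ| < a`" — and the hypothesis "∂^l f(0) = 0, l < k" expressed as the vanishing of all moments of order `< k`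
(`MomentsVanish k c`, in the binomial basis `Π_j binom(n_j, α_j)`; §10 `momentsVanish_of_monomial` derives it from the
vanishing of the monomial moments `Σ_n c(n) n^β`, `|β| < k`, which is literally `∂^β f(0) = 0` since
`∂^β f(0) = (−i)^{|β|} Σ_n c(n) n^β` for an absolutely convergent trigonometric series).  Multiplication of `f̃` by
`z_μ − 1` is the lattice difference `(Δ_μ g)(n) = g(n − e_μ) − g(n)` of the coefficients (`delta`; §9 `genFun_delta`).
* `gleason_coeff` (§8, THE LEMMA): for `0 < a`, `ExpBound a M c`, `MomentsVanish k c`: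
  `c = Σ_{μs : Fin k → Fin d} Δ_{μs 0} ⋯ Δ_{μs (k−1)} (potIter k c μs)` pointwise on `ℤ^d`, and EVERY potential decays at
  the SAME rate, `|potIter k c μs (n)| ≤ K(a,d)^k · M · e^{−a|n|₁}`, with the explicit constant `K(a,d) = C₁(a)^d`,
  `C₁(a) = (1 + Z(a))/(1 − e^{−a})`, `Z(a) = Σ_{x ∈ ℤ} e^{−a|x|}` (§5).  (No loss of rate on the coefficient side; the
  printed `a₁ < a₂` loss lives entirely in the passage sup-on-tube ↔ coefficient decay, see NOT reproduced.)
* `gleason_genFun` (§9, the printed multiplicative shape (14)/p. 248): on the closed poly-annulus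
  `e^{−b} ≤ |z_j| ≤ e^{b}`, `b < a` (`PolyAnnulus d b`; `= {|Im p_μ| ≤ b}` under `z_j = e^{−ip_j}`), all series converge
  absolutely and `Σ_n c(n) zⁿ = Σ_{μs} Π_j (z_{μs j} − 1) · Σ_n (potIter k c μs)(n) zⁿ`, with
  `|Σ_n (potIter k c μs)(n) zⁿ| ≤ K(a,d)^k · M · Z_d(a − b)`, `Z_d(b) = Σ_{n ∈ ℤ^d} e^{−b|n|₁}` (`ExpBound.norm_genFun_le`).
* Linearity (§11, printed "can be taken linearly depending on f"): `potIter_add`, `potIter_smul`.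
* The ingredients, all elementary and explicit: §3 the one-variable engine (`tail T x = Σ_{y > x} T(y)` is the
  decaying antidifference of a zero-sum exponentially decaying sequence, `norm_tail_le`, and Abel summation
  `tsum_mul_eq_tsum_tail_mul`); §5 the order-one potentials `pot` (direction `0`: fibrewise antidifference of
  `c −` (its fibre sums placed at `x = 0`); directions `≥ 1`: recursion on the marginal `marg c` in dimension `d − 1`)
  with `pot_bound`; §6 the reconstruction `c = Σ_μ Δ_μ (pot d c μ)` when `Σ c = 0` (`sum_delta_pot`); §7 moment transport
  (`momentsVanish_pot`: moments of order `< k+1` of `c` vanish ⇒ moments of order `< k` of each `pot d c μ` vanish — the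
  hockey-stick identity `Σ_x tail(T)(x) binom(x,b) = Σ_x T(x) binom(x,b+1)`, `tsum_tail_mul_choose`); §8 iteration in `k`.

**What is NOT reproduced.**  (i) The passage between the printed sup-norms on tubes and coefficient bounds: "analytic
and bounded by `S` on `|Im p_μ| < a₂`" ⇒ `|c(n)| ≤ S e^{−a₂|n|₁}` (the `d`-variable Cauchy estimate / contour shift) and,
conversely, coefficient decay at rate `a` ⇒ analytic on the open tube of width `a` with the sup bound of §9 on every closed
sub-tube — only the latter, elementary, direction is here (§9); with the former (standard, not formalised) the printed
inequality (4) follows from `gleason_genFun` with `C(d,k,a₁,a₂) = K(a₂,d)^k Z_d(a₂ − a₁)`, and "the same analyticity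
properties" (the full open tube of width `a`) from the fact that the potentials `potIter k c μs` do not depend on
`a` or `M`, so that they obey the §8 bound at every rate `a₂ < a` at which `c` does.  (ii) The identification
`∂^β f(0) = (−i)^{|β|} Σ_n c(n) n^β` (termwise differentiation of an absolutely convergent trigonometric series) — §10
starts from the monomial moments.  (iii) G–K's own construction of the `f_{μ₁…μ_k}` ((7)–(13): Cauchy formula on the
poly-annulus and Taylor remainder) and their constant `C̄(d,k,a₁,a₂)` of (9): DIVERGENCE (recorded in the cell as D-b03.21) —
the potentials here are built by an explicit position-space antidifference recursion instead (a different, equally linear,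
solution of the same Gleason problem; the Lemma asserts existence, so any construction with the printed properties is a
proof of it; the constants differ and are not compared).  (iv) The applications: G–K (15)–(17)/(11.8)–(11.10), and Bałaban
CMP 109 §5 — there `Π_{μν}(x)` with (5.10) `|Π_{μν}(x − y)| ≤ O(1)E₀ e^{−δ₁|x−y|}` is `c` with `a = δ₁`, `z_μ = e^{iζ_μ}` (5.17)
(the opposite sign convention, immaterial: apply the results to `n ↦ c(−n)`), the subtraction of the marginal quadratic
form `β(δ_{μν}Δ − ∂̄_μ∂_ν)` (5.36)/(5.37) makes the moments of order `≤ 2` vanish, and `k = 3` gives the third-order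
remainder (5.38) with coefficient kernels decaying as in (5.44) (printed rate `½δ₁`; rate `δ₁` on the coefficient side
here) — the B12-specific quadratic form, symmetries (5.12)–(5.15) and the regrouping into mixed `∂/∂̄` monomials are NOT
treated here (cell files `Balaban1983to89/B12Sec5Algebra.lean`, `B12Transversality.lean`).  Nothing in this file refers
to or asserts anything about Bałaban's β-functions (CMP 109 (1.22)) or any summit statement; it is a kernel certificate
of a printed-and-proved lemma of the cited literature.
-/

noncomputable section

open Finset Filter Topology

namespace Literature.MathematicalPhysics.QuantumFieldTheory.GawedzkiKupiainen1985.PeriodicGleason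

/-! ## §1 Lattice notation: `ℤ^d`, prepending a coordinate, the `ℓ¹` length, weights -/

/-- The lattice `ℤ^d` (positions `x ∈ ℤ^d` of the printed kernels / Fourier indices of the printed symbols).
[folklore] -/
abbrev Pt (d : ℕ) := Fin d → ℤ

variable {d : ℕ}

/-- Prepend a coordinate (the non-dependent `Fin.cons`). [folklore] -/
def scons {X : Type*} (x : X) (y : Fin d → X) : Fin (d + 1) → X := Fin.cons x y

/-- The head of `scons x y` is `x`. [folklore] -/
@[simp] theorem scons_zero {X : Type*} (x : X) (y : Fin d → X) : scons x y 0 = x := by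
  simp [scons]

/-- The tail entries of `scons x y` are those of `y`. [folklore] -/
@[simp] theorem scons_succ {X : Type*} (x : X) (y : Fin d → X) (i : Fin d) :
    scons x y i.succ = y i := by
  simp [scons]

/-- `Fin.tail (scons x y) = y`. [folklore] -/
@[simp] theorem tail_scons {X : Type*} (x : X) (y : Fin d → X) : Fin.tail (scons x y) = y := by
  simp [scons]

/-- Every point of `ℤ^(d+1)` is `scons` of its head and tail. [folklore] -/
theorem scons_self_tail {X : Type*} (n : Fin (d + 1) → X) : scons (n 0) (Fin.tail n) = n := by
  simp [scons]

/-- Every point of `ℤ^(d+1)` is of the form `scons x y`. [folklore] -/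
theorem exists_eq_scons {X : Type*} (n : Fin (d + 1) → X) : ∃ x y, n = scons x y :=
  ⟨n 0, Fin.tail n, (scons_self_tail n).symm⟩

/-- `(y, x) ↦ (x, y₁, …, y_d)`: `X^d × X ≃ X^{d+1}`. [folklore] -/
def consEquiv (d : ℕ) {X : Type*} : (Fin d → X) × X ≃ (Fin (d + 1) → X) where
  toFun p := scons p.2 p.1
  invFun n := (Fin.tail n, n 0)
  left_inv p := by simp
  right_inv n := by simp [scons_self_tail]

/-- `consEquiv` is `scons` on pairs. [folklore] -/
@[simp] theorem consEquiv_apply {X : Type*} (p : (Fin d → X) × X) :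
    consEquiv d p = scons p.2 p.1 := rfl

/-- `|n|₁ = Σ_j |n_j|`, as a real number. [folklore] -/
def l1 (n : Pt d) : ℝ := ∑ j, |(n j : ℝ)|

/-- `0 ≤ |n|₁`. [folklore] -/
theorem l1_nonneg (n : Pt d) : 0 ≤ l1 n := Finset.sum_nonneg fun _ _ => abs_nonneg _

/-- `|n|₁` in dimension `d+1` = `|head| + |tail|₁`. [folklore] -/
theorem l1_succ (n : Pt (d + 1)) : l1 n = |(n 0 : ℝ)| + l1 (Fin.tail n) := by
  simp [l1, Fin.sum_univ_succ, Fin.tail]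

/-- `|scons x y|₁ = |x| + |y|₁`. [folklore] -/
@[simp] theorem l1_scons (x : ℤ) (y : Pt d) : l1 (scons x y) = |(x : ℝ)| + l1 y := by
  rw [l1_succ]; simp

/-- `|n|₁ = 0` in dimension `0`. [folklore] -/
@[simp] theorem l1_dim_zero (n : Pt 0) : l1 n = 0 := by simp [l1]

/-- `|0|₁ = 0`. [folklore] -/
@[simp] theorem l1_zero : l1 (0 : Pt d) = 0 := by simp [l1]

/-- The exponential weight `e^{-a|n|₁}`. [folklore] -/
def wt (a : ℝ) (n : Pt d) : ℝ := Real.exp (-a * l1 n)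

/-- The weight `e^(-a|n|₁)` is positive. [folklore] -/
theorem wt_pos (a : ℝ) (n : Pt d) : 0 < wt a n := Real.exp_pos _

/-- The weight at the origin is `1`. [folklore] -/
@[simp] theorem wt_zero (a : ℝ) : wt a (0 : Pt d) = 1 := by simp [wt]

/-- The weight factorises over `scons`. [folklore] -/
theorem wt_scons (a : ℝ) (x : ℤ) (y : Pt d) :
    wt a (scons x y) = Real.exp (-a * |(x : ℝ)|) * wt a y := by
  simp [wt, mul_add, Real.exp_add]

/-- The polynomial weight `Π_j (|n_j| + 1)^p` (only used to make moment sums absolutely convergent). [folklore] -/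
def pw (p : ℕ) (n : Pt d) : ℝ := ∏ j, (|(n j : ℝ)| + 1) ^ p

/-- The polynomial weight is positive. [folklore] -/
theorem pw_pos (p : ℕ) (n : Pt d) : 0 < pw p n :=
  Finset.prod_pos fun j _ => by positivity

/-- The polynomial weight factorises over `scons`. [folklore] -/
theorem pw_scons (p : ℕ) (x : ℤ) (y : Pt d) :
    pw p (scons x y) = (|(x : ℝ)| + 1) ^ p * pw p y := by
  simp [pw, Fin.prod_univ_succ]

/-- The polynomial weight of exponent `0` is `1`. [folklore] -/
@[simp] theorem pw_zero_exp (n : Pt d) : pw 0 n = 1 := by simp [pw]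

/-- Exponential decay of a lattice kernel: `|c(n)| ≤ M e^{-a|n|₁}`.
[cite: GawedzkiKupiainenMasslessLattice1985, App. 2 Lemma p. 248 ("analytic for |Im p_j| < a", coefficient side)] -/
def ExpBound (a M : ℝ) (c : Pt d → ℂ) : Prop := ∀ n, ‖c n‖ ≤ M * wt a n

/-- An exponential bound forces `0 ≤ M` (evaluate at the origin). [folklore] -/
theorem ExpBound.nonneg {a M : ℝ} {c : Pt d → ℂ} (h : ExpBound a M c) : 0 ≤ M := by
  have := h 0
  rw [wt_zero, mul_one] at this
  exact (norm_nonneg _).trans this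

/-- Monotonicity of `ExpBound` in the constant. [folklore] -/
theorem ExpBound.mono {a M M' : ℝ} {c : Pt d → ℂ} (h : ExpBound a M c) (hM : M ≤ M') :
    ExpBound a M' c := fun n =>
  (h n).trans (mul_le_mul_of_nonneg_right hM (wt_pos a n).le)

/-- The unit vector `e_μ`. [folklore] -/
def unitVec (μ : Fin d) : Pt d := fun j => if j = μ then 1 else 0

/-- The lattice difference `(Δ_μ g)(n) = g(n - e_μ) - g(n)`; on generating functions `Σ_n g(n) zⁿ` it is
multiplication by `z_μ - 1` (`genFun_delta` below), i.e. by the printed factor `e^{-ip_μ} - 1` at `z = e^{-ip}`.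
[cite: GawedzkiKupiainenMasslessLattice1985, App. 2 Lemma p. 248 (the factor e^(-ip_μ) − 1) / (14) p. 250 (z_μ − 1)] -/
def delta (μ : Fin d) (g : Pt d → ℂ) (n : Pt d) : ℂ := g (n - unitVec μ) - g n

/-- `scons x y − e_0 = scons (x − 1) y`. [folklore] -/
theorem scons_sub_unitVec_zero (x : ℤ) (y : Pt d) :
    scons x y - unitVec (0 : Fin (d + 1)) = scons (x - 1) y := by
  funext i
  refine Fin.cases ?_ (fun i' => ?_) i
  · simp [unitVec]
  · simp [unitVec, Fin.succ_ne_zero]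

/-- `scons x y − e_(μ+1) = scons x (y − e_μ)`. [folklore] -/
theorem scons_sub_unitVec_succ (x : ℤ) (y : Pt d) (μ : Fin d) :
    scons x y - unitVec μ.succ = scons x (y - unitVec μ) := by
  funext i
  refine Fin.cases ?_ (fun i' => ?_) i
  · simp [unitVec, (Fin.succ_ne_zero μ).symm]
  · simp [unitVec, Fin.succ_inj]

/-- `Δ_μ` commutes with finite sums. [folklore] -/
theorem delta_finset_sum {ι : Type*} (s : Finset ι) (μ : Fin d) (g : ι → Pt d → ℂ) (n : Pt d) :
    delta μ (fun m => ∑ i ∈ s, g i m) n = ∑ i ∈ s, delta μ (g i) n := by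
  simp [delta, Finset.sum_sub_distrib]

/-- The binomial weight `B_α(n) = Π_j binom(n_j, α_j)` (`binom(x, a) = x(x-1)⋯(x-a+1)/a!` for `x ∈ ℤ`,
Mathlib's `Ring.choose`), a polynomial of degree `α_j` in each `n_j`. [folklore] -/
def binw (α : Fin d → ℕ) (n : Pt d) : ℂ := ∏ j, ((Ring.choose (n j) (α j) : ℤ) : ℂ)

/-- The order `|α| = Σ_j α_j` of a multi-index. [folklore] -/
def deg (α : Fin d → ℕ) : ℕ := ∑ j, α j

/-- The binomial weight factorises over `scons`. [folklore] -/
@[simp] theorem binw_scons (b : ℕ) (α : Fin d → ℕ) (x : ℤ) (y : Pt d) :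
    binw (scons b α) (scons x y) = ((Ring.choose x b : ℤ) : ℂ) * binw α y := by
  simp [binw, Fin.prod_univ_succ]

/-- `|scons b β| = b + |β|`. [folklore] -/
@[simp] theorem deg_scons (b : ℕ) (α : Fin d → ℕ) : deg (scons b α) = b + deg α := by
  simp [deg, Fin.sum_univ_succ]

/-- The binomial weight of multi-index `0` is `1`. [folklore] -/
@[simp] theorem binw_zero_idx (n : Pt d) : binw (0 : Fin d → ℕ) n = 1 := by
  simp [binw]

/-- `|0| = 0`. [folklore] -/
@[simp] theorem deg_zero : deg (0 : Fin d → ℕ) = 0 := by simp [deg]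

/-- Each entry of a multi-index is at most its degree. [folklore] -/
theorem le_deg (α : Fin d → ℕ) (j : Fin d) : α j ≤ deg α :=
  Finset.single_le_sum (f := α) (fun _ _ => Nat.zero_le _) (Finset.mem_univ j)

/-- The degree of the tail is at most the degree. [folklore] -/
theorem deg_tail_le (α : Fin (d + 1) → ℕ) : deg (Fin.tail α) ≤ deg α := by
  conv_rhs => rw [← scons_self_tail α]
  rw [deg_scons]; omega

/-- The binomial moment `Σ_n c(n) B_α(n)`.
[cite: GawedzkiKupiainenMasslessLattice1985, App. 2 Lemma p. 248 (hypothesis ∂^l f(0) = 0, l < k) / (6) p. 249] -/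
def moment (c : Pt d → ℂ) (α : Fin d → ℕ) : ℂ := ∑' n, c n * binw α n

/-- All binomial moments of order `< k` vanish (for an exponentially decaying kernel this is the same as the
vanishing of all monomial moments `Σ_n c(n) n^β`, `|β| < k` — `momentsVanish_of_monomial` — i.e. of all partial
derivatives of order `< k` of the symbol `Σ_n c(n) e^{-ipn}` at `p = 0`, the printed hypothesis).
[cite: GawedzkiKupiainenMasslessLattice1985, App. 2 Lemma p. 248 (hypothesis ∂^l f(0) = 0, l < k) / (6) p. 249] -/
def MomentsVanish (k : ℕ) (c : Pt d → ℂ) : Prop := ∀ α : Fin d → ℕ, deg α < k → moment c α = 0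

/-! ## §2 Absolute convergence: the weights `e^{-a|n|₁}·poly(n)` are summable over `ℤ^d` -/

/-- `Σ_(x ∈ ℕ) (x+1)^p e^(-ax)` converges for `a > 0`. [folklore] -/
theorem summable_nat_wt {a : ℝ} (ha : 0 < a) (p : ℕ) :
    Summable fun n : ℕ => Real.exp (-a * n) * ((n : ℝ) + 1) ^ p := by
  have h := Real.summable_pow_mul_exp_neg_nat_mul p ha
  have h1 : Summable fun n : ℕ => (((n + 1 : ℕ) : ℝ)) ^ p * Real.exp (-a * ((n + 1 : ℕ) : ℝ)) :=
    (summable_nat_add_iff 1).mpr h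
  have hE : Real.exp a * Real.exp (-a) = 1 := by rw [← Real.exp_add]; simp
  refine (h1.mul_left (Real.exp a)).congr fun n => ?_
  push_cast
  rw [show -a * ((n : ℝ) + 1) = -a * n + -a by ring, Real.exp_add]
  calc Real.exp a * (((n : ℝ) + 1) ^ p * (Real.exp (-a * n) * Real.exp (-a)))
      = (Real.exp a * Real.exp (-a)) * (Real.exp (-a * n) * ((n : ℝ) + 1) ^ p) := by ring
    _ = Real.exp (-a * n) * ((n : ℝ) + 1) ^ p := by rw [hE, one_mul]

/-- `Σ_(x ∈ ℤ) (|x|+1)^p e^(-a|x|)` converges for `a > 0`. [folklore] -/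
theorem summable_int_wt {a : ℝ} (ha : 0 < a) (p : ℕ) :
    Summable fun x : ℤ => Real.exp (-a * |(x : ℝ)|) * (|(x : ℝ)| + 1) ^ p := by
  refine summable_int_iff_summable_nat_and_neg.mpr ⟨?_, ?_⟩
  · simpa using summable_nat_wt ha p
  · simpa using summable_nat_wt ha p

/-- `Σ_(n ∈ ℤ^d) (Π_j (|n_j|+1)^p) e^(-a|n|₁)` converges for `a > 0` (product structure). [folklore] -/
theorem summable_wt_pw {a : ℝ} (ha : 0 < a) (p : ℕ) :
    ∀ d : ℕ, Summable fun n : Pt d => wt a n * pw p n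
  | 0 => Summable.of_finite
  | d + 1 => by
    have h := (summable_wt_pw ha p d).mul_of_nonneg (summable_int_wt ha p)
      (fun n => mul_nonneg (wt_pos a n).le (pw_pos p n).le) (fun x => by positivity)
    refine (consEquiv d).summable_iff.mp (h.congr fun q => ?_)
    simp only [Function.comp, consEquiv_apply, wt_scons, pw_scons]
    ring

/-- A kernel with `ExpBound` times anything of polynomial growth is absolutely summable. [folklore] -/
theorem ExpBound.summable_mul {a M : ℝ} {c : Pt d → ℂ} (hc : ExpBound a M c) (ha : 0 < a)
    {F : Pt d → ℂ} {K : ℝ} {p : ℕ} (hF : ∀ n, ‖F n‖ ≤ K * pw p n) :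
    Summable fun n => c n * F n := by
  refine Summable.of_norm_bounded ((summable_wt_pw ha p d).mul_left (M * K)) fun n => ?_
  rw [norm_mul]
  calc ‖c n‖ * ‖F n‖ ≤ (M * wt a n) * (K * pw p n) :=
        mul_le_mul (hc n) (hF n) (norm_nonneg _) (mul_nonneg hc.nonneg (wt_pos a n).le)
    _ = M * K * (wt a n * pw p n) := by ring

/-- An exponentially bounded kernel is summable. [folklore] -/
theorem ExpBound.summable {a M : ℝ} {c : Pt d → ℂ} (hc : ExpBound a M c) (ha : 0 < a) :
    Summable c := by
  have := hc.summable_mul ha (F := fun _ => 1) (K := 1) (p := 0) (fun n => by simp)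
  simpa using this

/-- An exponentially bounded kernel is absolutely summable. [folklore] -/
theorem ExpBound.summable_norm {a M : ℝ} {c : Pt d → ℂ} (hc : ExpBound a M c) (ha : 0 < a) :
    Summable fun n => ‖c n‖ :=
  Summable.of_nonneg_of_le (fun n => norm_nonneg _) hc
    ((by simpa using summable_wt_pw ha 0 d : Summable fun n : Pt d => wt a n).mul_left M)

/-- One-dimensional version. [folklore] -/
theorem summable_of_int_bound {T : ℤ → ℂ} {M a : ℝ} (ha : 0 < a) (p : ℕ)
    (hT : ∀ y, ‖T y‖ ≤ M * Real.exp (-a * |(y : ℝ)|) * (|(y : ℝ)| + 1) ^ p) : Summable T :=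
  Summable.of_norm_bounded ((summable_int_wt ha p).mul_left M) fun y => by
    simpa [mul_assoc] using hT y

/-- A sequence on `ℤ` bounded by `M e^(-a|x|)` is summable. [folklore] -/
theorem summable_of_int_bound₀ {T : ℤ → ℂ} {M a : ℝ} (ha : 0 < a)
    (hT : ∀ y, ‖T y‖ ≤ M * Real.exp (-a * |(y : ℝ)|)) : Summable T :=
  summable_of_int_bound ha 0 fun y => by simpa using hT y

/-! ### Polynomial growth of the binomials -/

/-- `|binom(x, j)| ≤ (|x| + j)^j` for `x ∈ ℤ` (polynomial, not exponential, growth — needed for every `a > 0`).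
[folklore] -/
theorem natAbs_choose_le (x : ℤ) (j : ℕ) : (Ring.choose x j).natAbs ≤ (x.natAbs + j) ^ j := by
  rcases Nat.eq_zero_or_pos j with rfl | hj
  · simp
  obtain ⟨m, rfl | rfl⟩ := Int.eq_nat_or_neg x
  · rw [Ring.choose_natCast]
    simp only [Int.natAbs_natCast]
    exact (Nat.choose_le_pow m j).trans (Nat.pow_le_pow_left (Nat.le_add_right m j) j)
  · rw [Ring.choose_neg]
    obtain ⟨j', rfl⟩ := Nat.exists_eq_succ_of_ne_zero hj.ne'
    have h1 : ((m : ℤ) + ((j' + 1 : ℕ) : ℤ) - 1) = ((m + j' : ℕ) : ℤ) := by push_cast; ring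
    rw [h1, Ring.choose_natCast, Units.smul_def, smul_eq_mul, Int.natAbs_mul, Int.units_natAbs, one_mul,
      Int.natAbs_natCast, Int.natAbs_neg, Int.natAbs_natCast]
    exact (Nat.choose_le_pow _ _).trans (Nat.pow_le_pow_left (by omega) _)

/-- `|binom(x, j)| ≤ (|x| + j)^j` in `ℂ`. [folklore] -/
theorem norm_choose_le (x : ℤ) (j : ℕ) : ‖((Ring.choose x j : ℤ) : ℂ)‖ ≤ (|(x : ℝ)| + j) ^ j := by
  rw [Complex.norm_intCast]
  have h : (((Ring.choose x j).natAbs : ℕ) : ℝ) ≤ (((x.natAbs + j) ^ j : ℕ) : ℝ) := by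
    exact_mod_cast natAbs_choose_le x j
  simpa [Nat.cast_natAbs] using h

/-- `|binom(x, j)| ≤ (q+1)^q (|x|+1)^q` for `j ≤ q`. [folklore] -/
theorem norm_choose_le' (x : ℤ) {j q : ℕ} (hj : j ≤ q) :
    ‖((Ring.choose x j : ℤ) : ℂ)‖ ≤ ((q : ℝ) + 1) ^ q * (|(x : ℝ)| + 1) ^ q := by
  have hq : (j : ℝ) ≤ q := by exact_mod_cast hj
  calc ‖((Ring.choose x j : ℤ) : ℂ)‖ ≤ (|(x : ℝ)| + j) ^ j := norm_choose_le x j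
    _ ≤ (((q : ℝ) + 1) * (|(x : ℝ)| + 1)) ^ j := by
        apply pow_le_pow_left₀ (by positivity)
        nlinarith [abs_nonneg (x : ℝ)]
    _ ≤ (((q : ℝ) + 1) * (|(x : ℝ)| + 1)) ^ q := by
        apply pow_le_pow_right₀ ?_ hj
        nlinarith [abs_nonneg (x : ℝ)]
    _ = _ := mul_pow _ _ _

/-- Binomial weights of degree `≤ p` per entry grow at most like `(p+1)^(pd) Π_j (|n_j|+1)^p`. [folklore] -/
theorem norm_binw_le (α : Fin d → ℕ) {p : ℕ} (hp : ∀ j, α j ≤ p) (n : Pt d) :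
    ‖binw α n‖ ≤ ((p : ℝ) + 1) ^ (p * d) * pw p n := by
  calc ‖binw α n‖ = ∏ j, ‖((Ring.choose (n j) (α j) : ℤ) : ℂ)‖ := by simp [binw, norm_prod]
    _ ≤ ∏ j, (((p : ℝ) + 1) ^ p * (|(n j : ℝ)| + 1) ^ p) :=
        Finset.prod_le_prod (fun j _ => norm_nonneg _) fun j _ => norm_choose_le' (n j) (hp j)
    _ = ((p : ℝ) + 1) ^ (p * d) * pw p n := by
        rw [Finset.prod_mul_distrib, Finset.prod_const, Finset.card_univ, Fintype.card_fin, pw, ← pow_mul]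

/-- Moments of exponentially bounded kernels converge absolutely. [folklore] -/
theorem ExpBound.summable_binw {a M : ℝ} {c : Pt d → ℂ} (hc : ExpBound a M c) (ha : 0 < a)
    (α : Fin d → ℕ) : Summable fun n => c n * binw α n :=
  hc.summable_mul ha (norm_binw_le α (fun j => le_deg α j))

/-! ## §3 The one-dimensional engine: tail sums (the discrete antiderivative) -/

/-- `(tail T)(x) = Σ_{y > x} T(y)`. [folklore] -/
def tail (T : ℤ → ℂ) (x : ℤ) : ℂ := ∑' y, (Set.Ioi x).indicator T y

/-- `1_(y > x−1) T − 1_(y > x) T = 1_(y = x) T` pointwise. [folklore] -/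
theorem indicator_Ioi_pred_sub (T : ℤ → ℂ) (x y : ℤ) :
    (Set.Ioi (x - 1)).indicator T y - (Set.Ioi x).indicator T y = if y = x then T y else 0 := by
  rcases lt_trichotomy y x with h | rfl | h
  · have h1 : y ∉ Set.Ioi (x - 1) := by simp; omega
    have h2 : y ∉ Set.Ioi x := by simp; omega
    simp [Set.indicator_of_notMem h1, Set.indicator_of_notMem h2, h.ne]
  · simp
  · have h1 : y ∈ Set.Ioi (x - 1) := by simp; omega
    have h2 : y ∈ Set.Ioi x := h
    simp [Set.indicator_of_mem h1, Set.indicator_of_mem h2, h.ne']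

/-- `Δ(tail T) = T`: `(tail T)(x-1) - (tail T)(x) = T(x)`. [folklore] -/
theorem tail_pred_sub (T : ℤ → ℂ) (hT : Summable T) (x : ℤ) : tail T (x - 1) - tail T x = T x := by
  unfold tail
  rw [← (hT.indicator _).tsum_sub (hT.indicator _)]
  simp_rw [indicator_Ioi_pred_sub]
  exact tsum_ite_eq x T

/-- An indicator does not increase the norm. [folklore] -/
theorem norm_indicator_le {T : ℤ → ℂ} {M a : ℝ} (hT : ∀ y, ‖T y‖ ≤ M * Real.exp (-a * |(y : ℝ)|))
    (s : Set ℤ) (y : ℤ) :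
    ‖s.indicator T y‖ ≤ s.indicator (fun y : ℤ => M * Real.exp (-a * |(y : ℝ)|)) y := by
  by_cases h : y ∈ s
  · rw [Set.indicator_of_mem h, Set.indicator_of_mem h]; exact hT y
  · simp [Set.indicator_of_notMem h]

/-- The geometric tail `Σ_(y > x) M e^(-a|y|) = M e^(-a(x+1))/(1 − e^(-a))` for `x ≥ 0`. [folklore] -/
theorem hasSum_indicator_Ioi {a : ℝ} (ha : 0 < a) (M : ℝ) {x : ℤ} (hx : 0 ≤ x) :
    HasSum (fun y : ℤ => (Set.Ioi x).indicator (fun y : ℤ => M * Real.exp (-a * |(y : ℝ)|)) y)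
      (M * Real.exp (-a * (x + 1)) / (1 - Real.exp (-a))) := by
  have hr0 : 0 ≤ Real.exp (-a) := (Real.exp_pos _).le
  have hr1 : Real.exp (-a) < 1 := Real.exp_lt_one_iff.mpr (by linarith)
  have hg : Function.Injective fun j : ℕ => x + 1 + j := by
    intro i j h; simpa using h
  have key := (hasSum_geometric_of_lt_one hr0 hr1).mul_left (M * Real.exp (-a * (x + 1)))
  refine (hg.hasSum_iff ?_).mp ?_
  · intro y hy
    apply Set.indicator_of_notMem
    intro hxy
    simp only [Set.mem_Ioi] at hxy
    exact hy ⟨(y - x - 1).toNat, by simp only; rw [Int.toNat_of_nonneg (by omega)]; omega⟩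
  · have hfun : ((fun y : ℤ => (Set.Ioi x).indicator (fun y : ℤ => M * Real.exp (-a * |(y : ℝ)|)) y) ∘
        fun j : ℕ => x + 1 + j) = fun j : ℕ => M * Real.exp (-a * (x + 1)) * Real.exp (-a) ^ j := by
      funext j
      have hmem : x + 1 + (j : ℤ) ∈ Set.Ioi x := by simp only [Set.mem_Ioi]; omega
      simp only [Function.comp, Set.indicator_of_mem hmem]
      have h0 : (0 : ℝ) ≤ ((x + 1 + j : ℤ) : ℝ) := by exact_mod_cast (by omega : (0 : ℤ) ≤ x + 1 + j)
      rw [abs_of_nonneg h0, ← Real.exp_nat_mul, mul_assoc, ← Real.exp_add]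
      push_cast
      congr 2; ring
    rw [hfun, div_eq_mul_inv]
    exact key

/-- The geometric tail `Σ_(y ≤ x) M e^(-a|y|) = M e^(-a|x|)/(1 − e^(-a))` for `x ≤ 0`. [folklore] -/
theorem hasSum_indicator_Iic {a : ℝ} (ha : 0 < a) (M : ℝ) {x : ℤ} (hx : x ≤ 0) :
    HasSum (fun y : ℤ => (Set.Iic x).indicator (fun y : ℤ => M * Real.exp (-a * |(y : ℝ)|)) y)
      (M * Real.exp (-a * |(x : ℝ)|) / (1 - Real.exp (-a))) := by
  have hr0 : 0 ≤ Real.exp (-a) := (Real.exp_pos _).le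
  have hr1 : Real.exp (-a) < 1 := Real.exp_lt_one_iff.mpr (by linarith)
  have hg : Function.Injective fun j : ℕ => x - j := by
    intro i j h; simpa using h
  have key := (hasSum_geometric_of_lt_one hr0 hr1).mul_left (M * Real.exp (-a * |(x : ℝ)|))
  refine (hg.hasSum_iff ?_).mp ?_
  · intro y hy
    apply Set.indicator_of_notMem
    intro hxy
    simp only [Set.mem_Iic] at hxy
    exact hy ⟨(x - y).toNat, by simp only; rw [Int.toNat_of_nonneg (by omega)]; omega⟩
  · have hfun : ((fun y : ℤ => (Set.Iic x).indicator (fun y : ℤ => M * Real.exp (-a * |(y : ℝ)|)) y) ∘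
        fun j : ℕ => x - j) = fun j : ℕ => M * Real.exp (-a * |(x : ℝ)|) * Real.exp (-a) ^ j := by
      funext j
      have hmem : x - (j : ℤ) ∈ Set.Iic x := by simp only [Set.mem_Iic]; omega
      simp only [Function.comp, Set.indicator_of_mem hmem]
      have h0 : ((x - j : ℤ) : ℝ) ≤ 0 := by exact_mod_cast (by omega : x - (j : ℤ) ≤ 0)
      have h0' : ((x : ℤ) : ℝ) ≤ 0 := by exact_mod_cast hx
      rw [abs_of_nonpos h0, abs_of_nonpos h0', ← Real.exp_nat_mul, mul_assoc, ← Real.exp_add]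
      push_cast
      congr 2; ring
    rw [hfun, div_eq_mul_inv]
    exact key

/-- Exponential decay of the tail sums of a kernel with total sum zero (no loss of rate). [folklore] -/
theorem norm_tail_le {T : ℤ → ℂ} {M a : ℝ} (ha : 0 < a)
    (hT : ∀ y, ‖T y‖ ≤ M * Real.exp (-a * |(y : ℝ)|)) (h0 : ∑' y, T y = 0) (x : ℤ) :
    ‖tail T x‖ ≤ M / (1 - Real.exp (-a)) * Real.exp (-a * |(x : ℝ)|) := by
  have hM : 0 ≤ M := by
    have := hT 0
    simp only [Int.cast_zero, abs_zero, mul_zero, Real.exp_zero, mul_one] at this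
    exact (norm_nonneg _).trans this
  have hq : 0 < 1 - Real.exp (-a) := by
    have := Real.exp_lt_one_iff.mpr (show -a < 0 by linarith); linarith
  have hTs : Summable T := summable_of_int_bound₀ ha hT
  rcases le_or_gt 0 x with hx | hx
  · have hS := hasSum_indicator_Ioi ha M hx
    have hn : Summable fun y => ‖(Set.Ioi x).indicator T y‖ :=
      Summable.of_nonneg_of_le (fun y => norm_nonneg _) (norm_indicator_le hT _) hS.summable
    calc ‖tail T x‖ ≤ ∑' y, ‖(Set.Ioi x).indicator T y‖ := norm_tsum_le_tsum_norm hn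
      _ ≤ ∑' y, (Set.Ioi x).indicator (fun y : ℤ => M * Real.exp (-a * |(y : ℝ)|)) y :=
          hn.tsum_le_tsum (norm_indicator_le hT _) hS.summable
      _ = M * Real.exp (-a * (x + 1)) / (1 - Real.exp (-a)) := hS.tsum_eq
      _ ≤ M / (1 - Real.exp (-a)) * Real.exp (-a * |(x : ℝ)|) := by
          rw [abs_of_nonneg (by exact_mod_cast hx), div_mul_eq_mul_div]
          apply div_le_div_of_nonneg_right _ hq.le
          exact mul_le_mul_of_nonneg_left (Real.exp_le_exp.mpr (by nlinarith)) hM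
  · have heq : tail T x = -∑' y, (Set.Iic x).indicator T y := by
      unfold tail
      have h1 : ∀ y, (Set.Ioi x).indicator T y = T y - (Set.Iic x).indicator T y := by
        intro y
        have := congrFun (Set.indicator_compl (Set.Iic x) T) y
        simpa [Set.compl_Iic] using this
      simp_rw [h1]
      rw [hTs.tsum_sub (hTs.indicator _), h0, zero_sub]
    have hS := hasSum_indicator_Iic ha M hx.le
    have hn : Summable fun y => ‖(Set.Iic x).indicator T y‖ :=
      Summable.of_nonneg_of_le (fun y => norm_nonneg _) (norm_indicator_le hT _) hS.summable
    rw [heq, norm_neg]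
    calc ‖∑' y, (Set.Iic x).indicator T y‖ ≤ ∑' y, ‖(Set.Iic x).indicator T y‖ :=
          norm_tsum_le_tsum_norm hn
      _ ≤ ∑' y, (Set.Iic x).indicator (fun y : ℤ => M * Real.exp (-a * |(y : ℝ)|)) y :=
          hn.tsum_le_tsum (norm_indicator_le hT _) hS.summable
      _ = M * Real.exp (-a * |(x : ℝ)|) / (1 - Real.exp (-a)) := hS.tsum_eq
      _ = M / (1 - Real.exp (-a)) * Real.exp (-a * |(x : ℝ)|) := by ring

/-- Abel summation against the tail sums: `Σ T·G = Σ (tail T)·(G(·+1) - G)`. [folklore] -/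
theorem tsum_mul_eq_tsum_tail_mul {T : ℤ → ℂ} (hT : Summable T) (G : ℤ → ℂ)
    (h1 : Summable fun x => tail T x * G x) (h2 : Summable fun x => tail T x * G (x + 1)) :
    ∑' x, T x * G x = ∑' x, tail T x * (G (x + 1) - G x) := by
  have h2' : Summable fun x => tail T (x - 1) * G x := by
    have := h2.comp_injective (sub_left_injective : Function.Injective fun x : ℤ => x - 1)
    refine this.congr fun x => ?_
    simp [Function.comp, sub_add_cancel]
  have hshift : ∑' x, tail T (x - 1) * G x = ∑' x, tail T x * G (x + 1) := by
    rw [← (Equiv.addRight (1 : ℤ)).tsum_eq (fun x => tail T (x - 1) * G x)]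
    simp
  calc ∑' x, T x * G x = ∑' x, (tail T (x - 1) * G x - tail T x * G x) := by
        refine tsum_congr fun x => ?_
        rw [← sub_mul, tail_pred_sub T hT]
    _ = ∑' x, tail T (x - 1) * G x - ∑' x, tail T x * G x := h2'.tsum_sub h1
    _ = ∑' x, tail T x * G (x + 1) - ∑' x, tail T x * G x := by rw [hshift]
    _ = ∑' x, tail T x * (G (x + 1) - G x) := by
        rw [← h2.tsum_sub h1]
        exact tsum_congr fun x => by ring

/-! ## §4 Fubini along the first coordinate -/

/-- Fubini over the first coordinate: `Σ_(n ∈ ℤ^(d+1)) F(n) = Σ_y Σ_x F(scons x y)` for summable `F`. [folklore] -/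
theorem tsum_succ_dim (F : Pt (d + 1) → ℂ) (hF : Summable F) :
    ∑' n, F n = ∑' y : Pt d, ∑' x : ℤ, F (scons x y) := by
  rw [← (consEquiv d).tsum_eq F]
  have hF' : Summable (F ∘ consEquiv d) := (consEquiv d).summable_iff.mpr hF
  exact hF'.tsum_prod' (fun y => hF'.prod_factor y)

/-- Every fibre `x ↦ c(scons x y)` of an exponentially bounded kernel is summable. [folklore] -/
theorem ExpBound.summable_scons {a M : ℝ} {c : Pt (d + 1) → ℂ} (hc : ExpBound a M c) (ha : 0 < a)
    (y : Pt d) : Summable fun x : ℤ => c (scons x y) :=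
  summable_of_int_bound₀ ha (M := M * wt a y) fun x => by
    refine (hc _).trans (le_of_eq ?_)
    rw [wt_scons]; ring

/-! ## §5 The one-step (order 1) decomposition, by recursion on the dimension

`marg c` = the marginal over the first coordinate; `spike c` = that marginal re-inserted on the hyperplane
`{n₀ = 0}`; `headPart c = c - spike c` has zero sums along every fibre in the first coordinate direction,
so its fibrewise tail sums `pot c 0` satisfy `Δ₀ (pot c 0) = headPart c`; the spike is a kernel on `ℤ^{d}`
(one dimension down) with the same total sum and moments, decomposed recursively (`pot c μ.succ`). -/

/-- marginal over the first coordinate [folklore] -/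
def marg (c : Pt (d + 1) → ℂ) (y : Pt d) : ℂ := ∑' x : ℤ, c (scons x y)

/-- the marginal, supported on the hyperplane `n₀ = 0` [folklore] -/
def spike (c : Pt (d + 1) → ℂ) (n : Pt (d + 1)) : ℂ := if n 0 = 0 then marg c (Fin.tail n) else 0

/-- `c` minus its spike: zero fibre sums in direction `0` [folklore] -/
def headPart (c : Pt (d + 1) → ℂ) (n : Pt (d + 1)) : ℂ := c n - spike c n

/-- the fibre of `headPart c` over `y ∈ ℤ^d` [folklore] -/
def fib (c : Pt (d + 1) → ℂ) (y : Pt d) (x : ℤ) : ℂ := headPart c (scons x y)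

/-- `spike c (scons x y) = [x = 0] · marg c y`. [folklore] -/
@[simp] theorem spike_scons (c : Pt (d + 1) → ℂ) (x : ℤ) (y : Pt d) :
    spike c (scons x y) = if x = 0 then marg c y else 0 := by
  simp [spike]

/-- THE POTENTIALS (order 1): `c = Σ_μ Δ_μ (pot d c μ)` whenever `Σ c = 0` (`sum_delta_pot`).
[cite: GawedzkiKupiainenMasslessLattice1985, App. 2 Lemma p. 248 (the f_μ, case k = 1)] -/
def pot : (d : ℕ) → (Pt d → ℂ) → Fin d → Pt d → ℂ
  | 0, _, μ, _ => μ.elim0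
  | d + 1, c, μ, n => Fin.cases (motive := fun _ => ℂ) (tail (fib c (Fin.tail n)) (n 0))
      (fun μ' => if n 0 = 0 then pot d (marg c) μ' (Fin.tail n) else 0) μ

/-- Direction `0`: `pot c 0 (scons x y)` is the tail sum of the fibre of `headPart c` over `y`. [folklore] -/
@[simp] theorem pot_zero_scons (c : Pt (d + 1) → ℂ) (x : ℤ) (y : Pt d) :
    pot (d + 1) c 0 (scons x y) = tail (fib c y) x := by
  simp [pot]

/-- Directions `≥ 1`: `pot c (μ+1) (scons x y) = [x = 0] · pot (marg c) μ y`. [folklore] -/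
@[simp] theorem pot_succ_scons (c : Pt (d + 1) → ℂ) (μ : Fin d) (x : ℤ) (y : Pt d) :
    pot (d + 1) c μ.succ (scons x y) = if x = 0 then pot d (marg c) μ y else 0 := by
  simp [pot]

/-- `Z(a) = Σ_{x ∈ ℤ} e^{-a|x|}` (`= coth(a/2)`; only its finiteness is used). [folklore] -/
def Z (a : ℝ) : ℝ := ∑' x : ℤ, Real.exp (-a * |(x : ℝ)|)

/-- `0 ≤ Z(a)`. [folklore] -/
theorem Z_nonneg (a : ℝ) : 0 ≤ Z a := tsum_nonneg fun _ => (Real.exp_pos _).le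

/-- The one-step constant `C₁(a) = (1 + Z(a)) / (1 - e^{-a})`. [folklore] -/
def C1 (a : ℝ) : ℝ := (1 + Z a) / (1 - Real.exp (-a))

/-- `0 < 1 − e^(-a)` for `a > 0`. [folklore] -/
theorem one_sub_exp_pos {a : ℝ} (ha : 0 < a) : 0 < 1 - Real.exp (-a) := by
  have := Real.exp_lt_one_iff.mpr (show -a < 0 by linarith); linarith

/-- `1 + Z(a) ≤ C₁(a)`. [folklore] -/
theorem one_add_Z_le_C1 {a : ℝ} (ha : 0 < a) : 1 + Z a ≤ C1 a := by
  rw [C1, le_div_iff₀ (one_sub_exp_pos ha)]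
  nlinarith [Z_nonneg a, Real.exp_pos (-a)]

/-- `1 ≤ C₁(a)`. [folklore] -/
theorem one_le_C1 {a : ℝ} (ha : 0 < a) : 1 ≤ C1 a := by linarith [one_add_Z_le_C1 ha, Z_nonneg a]

/-- `Z(a) ≤ C₁(a)`. [folklore] -/
theorem Z_le_C1 {a : ℝ} (ha : 0 < a) : Z a ≤ C1 a := by linarith [one_add_Z_le_C1 ha]

/-- The order-1 constant in dimension `d`: `K(a, d) = C₁(a)^d`. [folklore] -/
def K (a : ℝ) (d : ℕ) : ℝ := C1 a ^ d

/-- `0 ≤ K(a,d)`. [folklore] -/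
theorem K_nonneg {a : ℝ} (ha : 0 < a) (d : ℕ) : 0 ≤ K a d := pow_nonneg (zero_le_one.trans (one_le_C1 ha)) d

/-- `K(a,d) · C ≤ K(a,d+1) · C`-type monotonicity used in the recursion: `C₁(a) K(a,d) = K(a,d+1)`. [folklore] -/
theorem K_succ_ge {a : ℝ} (ha : 0 < a) (d : ℕ) : K a d ≤ K a (d + 1) := by
  unfold K; exact pow_le_pow_right₀ (one_le_C1 ha) (Nat.le_succ d)

/-- The marginal decays at the same rate: `|marg c (y)| ≤ M Z(a) e^(-a|y|₁)`. [folklore] -/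
theorem marg_bound {a M : ℝ} {c : Pt (d + 1) → ℂ} (ha : 0 < a) (hc : ExpBound a M c) :
    ExpBound a (M * Z a) (marg c) := by
  intro y
  have hZ : Summable fun x : ℤ => Real.exp (-a * |(x : ℝ)|) := by simpa using summable_int_wt ha 0
  have hmaj : Summable fun x : ℤ => M * wt a y * Real.exp (-a * |(x : ℝ)|) := hZ.mul_left _
  have hpt : ∀ x : ℤ, ‖c (scons x y)‖ ≤ M * wt a y * Real.exp (-a * |(x : ℝ)|) := fun x => by
    refine (hc _).trans (le_of_eq ?_); rw [wt_scons]; ring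
  have hn : Summable fun x : ℤ => ‖c (scons x y)‖ :=
    Summable.of_nonneg_of_le (fun _ => norm_nonneg _) hpt hmaj
  calc ‖marg c y‖ ≤ ∑' x : ℤ, ‖c (scons x y)‖ := norm_tsum_le_tsum_norm hn
    _ ≤ ∑' x : ℤ, M * wt a y * Real.exp (-a * |(x : ℝ)|) := hn.tsum_le_tsum hpt hmaj
    _ = M * Z a * wt a y := by rw [tsum_mul_left, Z]; ring

/-- The spike decays at the same rate, constant `M Z(a)`. [folklore] -/
theorem spike_bound {a M : ℝ} {c : Pt (d + 1) → ℂ} (ha : 0 < a) (hc : ExpBound a M c) :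
    ExpBound a (M * Z a) (spike c) := by
  intro n
  obtain ⟨x, y, rfl⟩ := exists_eq_scons n
  rw [spike_scons]
  split_ifs with hx
  · subst hx
    refine (marg_bound ha hc y).trans (le_of_eq ?_)
    simp [wt_scons]
  · simpa using mul_nonneg (mul_nonneg hc.nonneg (Z_nonneg a)) (wt_pos a (scons x y)).le

/-- `headPart c = c − spike c` decays at the same rate, constant `M(1 + Z(a))`. [folklore] -/
theorem headPart_bound {a M : ℝ} {c : Pt (d + 1) → ℂ} (ha : 0 < a) (hc : ExpBound a M c) :
    ExpBound a (M * (1 + Z a)) (headPart c) := fun n =>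
  calc ‖headPart c n‖ ≤ ‖c n‖ + ‖spike c n‖ := norm_sub_le _ _
    _ ≤ M * wt a n + M * Z a * wt a n := add_le_add (hc n) (spike_bound ha hc n)
    _ = M * (1 + Z a) * wt a n := by ring

/-- Each fibre of `headPart c` is bounded by `M(1+Z(a)) e^(-a|y|₁) · e^(-a|x|)`. [folklore] -/
theorem fib_bound {a M : ℝ} {c : Pt (d + 1) → ℂ} (ha : 0 < a) (hc : ExpBound a M c) (y : Pt d) (x : ℤ) :
    ‖fib c y x‖ ≤ M * (1 + Z a) * wt a y * Real.exp (-a * |(x : ℝ)|) := by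
  refine (headPart_bound ha hc (scons x y)).trans (le_of_eq ?_)
  rw [wt_scons]; ring

/-- Each fibre of `headPart c` is summable. [folklore] -/
theorem summable_fib {a M : ℝ} {c : Pt (d + 1) → ℂ} (ha : 0 < a) (hc : ExpBound a M c) (y : Pt d) :
    Summable (fib c y) :=
  summable_of_int_bound₀ ha (fib_bound ha hc y)

/-- Each fibre of `headPart c` has sum zero (the spike removed exactly the fibre sums). [folklore] -/
theorem tsum_fib {a M : ℝ} {c : Pt (d + 1) → ℂ} (ha : 0 < a) (hc : ExpBound a M c) (y : Pt d) :
    ∑' x, fib c y x = 0 := by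
  have h1 : Summable fun x : ℤ => c (scons x y) := hc.summable_scons ha y
  have h2 : Summable fun x : ℤ => spike c (scons x y) := by
    simp only [spike_scons]
    exact (hasSum_ite_eq (0 : ℤ) (marg c y)).summable
  simp only [fib, headPart]
  rw [h1.tsum_sub h2]
  simp only [spike_scons, tsum_ite_eq]
  simp [marg]

/-- The potentials decay at the same rate: `|pot d c μ (n)| ≤ K(a,d)·M·e^{-a|n|₁}` (no hypothesis on the
moments is needed for the bound).
[cite: GawedzkiKupiainenMasslessLattice1985, App. 2 Lemma p. 248 (4), case k = 1 ("same analyticity properties")] -/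
theorem pot_bound {a : ℝ} (ha : 0 < a) :
    ∀ (d : ℕ) {M : ℝ} {c : Pt d → ℂ}, ExpBound a M c → ∀ μ, ExpBound a (K a d * M) (pot d c μ)
  | 0, _, _, _, μ => μ.elim0
  | d + 1, M, c, hc, μ => by
    intro n
    obtain ⟨x, y, rfl⟩ := exists_eq_scons n
    have hK1 : C1 a ≤ K a (d + 1) := by
      unfold K; simpa using pow_le_pow_right₀ (one_le_C1 ha) (Nat.succ_le_succ (Nat.zero_le d))
    refine Fin.cases ?_ (fun μ' => ?_) μ
    · rw [pot_zero_scons]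
      have ht := norm_tail_le ha (fib_bound ha hc y) (tsum_fib ha hc y) x
      refine ht.trans ?_
      rw [wt_scons]
      have hw : 0 ≤ Real.exp (-a * |(x : ℝ)|) * wt a y := mul_nonneg (Real.exp_pos _).le (wt_pos a y).le
      have hq : (1 - Real.exp (-a)) ≠ 0 := (one_sub_exp_pos ha).ne'
      calc M * (1 + Z a) * wt a y / (1 - Real.exp (-a)) * Real.exp (-a * |(x : ℝ)|)
          = C1 a * M * (Real.exp (-a * |(x : ℝ)|) * wt a y) := by
            rw [C1]; field_simp
        _ ≤ K a (d + 1) * M * (Real.exp (-a * |(x : ℝ)|) * wt a y) := by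
            apply mul_le_mul_of_nonneg_right _ hw
            exact mul_le_mul_of_nonneg_right hK1 hc.nonneg
    · rw [pot_succ_scons]
      split_ifs with hx
      · subst hx
        have ih := pot_bound ha d (marg_bound ha hc) μ' y
        refine ih.trans ?_
        have hw : wt a (scons 0 y) = wt a y := by simp [wt_scons]
        rw [hw]
        have : K a d * (M * Z a) ≤ K a (d + 1) * M := by
          calc K a d * (M * Z a) = (K a d * Z a) * M := by ring
            _ ≤ (K a d * C1 a) * M := by
                gcongr
                · exact hc.nonneg
                · exact K_nonneg ha d
                · exact Z_le_C1 ha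
            _ = K a (d + 1) * M := by rw [K, K, pow_succ]
        exact mul_le_mul_of_nonneg_right this (wt_pos a y).le
      · simpa using mul_nonneg (mul_nonneg (K_nonneg ha (d + 1)) hc.nonneg) (wt_pos a (scons x y)).le

/-! ## §6 Reconstruction: `c = Σ_μ Δ_μ (pot d c μ)` when `Σ c = 0` -/

/-- The marginal has the same total sum. [folklore] -/
theorem tsum_marg {a M : ℝ} {c : Pt (d + 1) → ℂ} (ha : 0 < a) (hc : ExpBound a M c) :
    ∑' y, marg c y = ∑' n, c n :=
  (tsum_succ_dim c (hc.summable ha)).symm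

/-- **Reconstruction (order 1).** If `Σ c = 0` then `c = Σ_μ Δ_μ (pot d c μ)` on `ℤ^d`. [cite:
GawedzkiKupiainenMasslessLattice1985, App. 2 Lemma p. 248, case k = 1] -/
theorem sum_delta_pot {a : ℝ} (ha : 0 < a) :
    ∀ (d : ℕ) {M : ℝ} {c : Pt d → ℂ}, ExpBound a M c → ∑' n, c n = 0 →
      ∀ n, ∑ μ, delta μ (pot d c μ) n = c n
  | 0, _, c, _, h0, n => by
    have h1 : ∑' m, c m = c n := tsum_eq_single n fun m hm => (hm (Subsingleton.elim m n)).elim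
    rw [Finset.univ_eq_empty, Finset.sum_empty, ← h1, h0]
  | d + 1, M, c, hc, h0, n => by
    obtain ⟨x, y, rfl⟩ := exists_eq_scons n
    rw [Fin.sum_univ_succ]
    have hd0 : delta 0 (pot (d + 1) c 0) (scons x y) = fib c y x := by
      rw [delta, scons_sub_unitVec_zero, pot_zero_scons, pot_zero_scons]
      exact tail_pred_sub _ (summable_fib ha hc y) x
    have hds : ∀ μ' : Fin d, delta μ'.succ (pot (d + 1) c μ'.succ) (scons x y) =
        if x = 0 then delta μ' (pot d (marg c) μ') y else 0 := by
      intro μ'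
      rw [delta, scons_sub_unitVec_succ, pot_succ_scons, pot_succ_scons]
      split_ifs <;> simp [delta]
    have hmarg0 : ∑' y, marg c y = 0 := by rw [tsum_marg ha hc, h0]
    have ih := sum_delta_pot ha d (marg_bound ha hc) hmarg0 y
    rw [hd0]
    simp only [hds]
    split_ifs with hx
    · rw [ih]; subst hx; simp [fib, headPart]
    · simp [fib, headPart, hx]

/-! ## §7 Moments: the potentials of a kernel with vanishing moments of order `< k+1` have vanishing
moments of order `< k` -/

/-- Moments of the marginal are the moments of `c` with first index `0`. [folklore] -/
theorem moment_marg {a M : ℝ} {c : Pt (d + 1) → ℂ} (ha : 0 < a) (hc : ExpBound a M c)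
    (β : Fin d → ℕ) : moment (marg c) β = moment c (scons 0 β) := by
  symm
  unfold moment
  rw [tsum_succ_dim _ (hc.summable_binw ha _)]
  refine tsum_congr fun y => ?_
  simp only [binw_scons, Ring.choose_zero_right, Int.cast_one, one_mul, marg]
  rw [← tsum_mul_right]

/-- Vanishing moments pass to the marginal. [folklore] -/
theorem momentsVanish_marg {a M : ℝ} {c : Pt (d + 1) → ℂ} (ha : 0 < a) (hc : ExpBound a M c)
    {k : ℕ} (hm : MomentsVanish k c) : MomentsVanish k (marg c) := fun β hβ => by
  rw [moment_marg ha hc β]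
  exact hm _ (by simpa using hβ)

/-- Moments of the spike: `binom(0,b) ·` (moment of `c` with first index `0`). [folklore] -/
theorem moment_spike {a M : ℝ} {c : Pt (d + 1) → ℂ} (ha : 0 < a) (hc : ExpBound a M c)
    (b : ℕ) (β : Fin d → ℕ) :
    moment (spike c) (scons b β) = ((Ring.choose (0 : ℤ) b : ℤ) : ℂ) * moment c (scons 0 β) := by
  rw [← moment_marg ha hc β]
  unfold moment
  rw [tsum_succ_dim _ ((spike_bound ha hc).summable_binw ha _), ← tsum_mul_left]
  refine tsum_congr fun y => ?_
  rw [tsum_eq_single 0 (fun x hx => by simp [hx])]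
  simp; ring

/-- Vanishing moments pass to `headPart c`. [folklore] -/
theorem momentsVanish_headPart {a M : ℝ} {c : Pt (d + 1) → ℂ} (ha : 0 < a) (hc : ExpBound a M c)
    {k : ℕ} (hm : MomentsVanish k c) : MomentsVanish k (headPart c) := by
  intro α hα
  obtain ⟨b, β, rfl⟩ := exists_eq_scons α
  have h1 : moment c (scons b β) = 0 := hm _ hα
  have h2 : moment c (scons 0 β) = 0 := hm _ (by simp at hα ⊢; omega)
  unfold moment at h1 h2 ⊢
  simp only [headPart, sub_mul]
  rw [(hc.summable_binw ha _).tsum_sub ((spike_bound ha hc).summable_binw ha _), h1]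
  have h3 := moment_spike ha hc b β
  unfold moment at h3
  rw [h3, h2]; simp

/-- Summability of `tail T · binom(·, q)`-type products. [folklore] -/
theorem summable_tail_mul {T : ℤ → ℂ} {M a : ℝ} (ha : 0 < a)
    (hT : ∀ y, ‖T y‖ ≤ M * Real.exp (-a * |(y : ℝ)|)) (h0 : ∑' y, T y = 0)
    {G : ℤ → ℂ} {Kg : ℝ} {q : ℕ} (hG : ∀ x, ‖G x‖ ≤ Kg * (|(x : ℝ)| + 1) ^ q) :
    Summable fun x => tail T x * G x := by
  have hM : 0 ≤ M / (1 - Real.exp (-a)) := by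
    have := hT 0
    simp only [Int.cast_zero, abs_zero, mul_zero, Real.exp_zero, mul_one] at this
    exact div_nonneg ((norm_nonneg _).trans this) (one_sub_exp_pos ha).le
  refine summable_of_int_bound ha q (M := M / (1 - Real.exp (-a)) * Kg) fun x => ?_
  rw [norm_mul]
  calc ‖tail T x‖ * ‖G x‖ ≤ (M / (1 - Real.exp (-a)) * Real.exp (-a * |(x : ℝ)|)) * (Kg * (|(x : ℝ)| + 1) ^ q) :=
        mul_le_mul (norm_tail_le ha hT h0 x) (hG x) (norm_nonneg _) (mul_nonneg hM (Real.exp_pos _).le)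
    _ = _ := by ring

/-- `|binom(x+1, q)| ≤ (2(q+1))^q (|x|+1)^q`. [folklore] -/
theorem norm_choose_succ_le (x : ℤ) (q : ℕ) :
    ‖((Ring.choose (x + 1) q : ℤ) : ℂ)‖ ≤ (2 * ((q : ℝ) + 1)) ^ q * (|(x : ℝ)| + 1) ^ q := by
  refine (norm_choose_le' (x + 1) le_rfl).trans ?_
  have hx : |((x + 1 : ℤ) : ℝ)| + 1 ≤ 2 * (|(x : ℝ)| + 1) := by
    push_cast
    have := abs_add_le (x : ℝ) 1
    rw [abs_one] at this
    linarith [abs_nonneg (x : ℝ)]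
  calc ((q : ℝ) + 1) ^ q * (|((x + 1 : ℤ) : ℝ)| + 1) ^ q
      ≤ ((q : ℝ) + 1) ^ q * (2 * (|(x : ℝ)| + 1)) ^ q := by
        apply mul_le_mul_of_nonneg_left _ (by positivity)
        exact pow_le_pow_left₀ (by positivity) hx q
    _ = (2 * ((q : ℝ) + 1)) ^ q * (|(x : ℝ)| + 1) ^ q := by rw [mul_pow, mul_pow]; ring

/-- The 1-d moment shift: `Σ_x (tail T)(x) binom(x, b) = Σ_x T(x) binom(x, b+1)`. [folklore] -/
theorem tsum_tail_mul_choose {T : ℤ → ℂ} {M a : ℝ} (ha : 0 < a)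
    (hT : ∀ y, ‖T y‖ ≤ M * Real.exp (-a * |(y : ℝ)|)) (h0 : ∑' y, T y = 0) (b : ℕ) :
    ∑' x, tail T x * ((Ring.choose x b : ℤ) : ℂ) = ∑' x, T x * ((Ring.choose x (b + 1) : ℤ) : ℂ) := by
  have hTs : Summable T := summable_of_int_bound₀ ha hT
  have h1 : Summable fun x => tail T x * ((Ring.choose x (b + 1) : ℤ) : ℂ) :=
    summable_tail_mul ha hT h0 (fun x => norm_choose_le' x le_rfl)
  have h2 : Summable fun x => tail T x * ((Ring.choose (x + 1) (b + 1) : ℤ) : ℂ) :=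
    summable_tail_mul ha hT h0 (fun x => norm_choose_succ_le x (b + 1))
  rw [tsum_mul_eq_tsum_tail_mul hTs (fun x => ((Ring.choose x (b + 1) : ℤ) : ℂ)) h1 h2]
  refine tsum_congr fun x => ?_
  rw [Ring.choose_succ_succ]; push_cast; ring

/-- Moment transport in direction `0` (hockey stick): the `(b, β)`-moment of `pot c 0` is the `(b+1, β)`-moment of
`headPart c`. [folklore] -/
theorem moment_pot_zero {a M : ℝ} {c : Pt (d + 1) → ℂ} (ha : 0 < a) (hc : ExpBound a M c)
    (b : ℕ) (β : Fin d → ℕ) :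
    moment (pot (d + 1) c 0) (scons b β) = moment (headPart c) (scons (b + 1) β) := by
  unfold moment
  rw [tsum_succ_dim _ ((pot_bound ha (d + 1) hc 0).summable_binw ha _),
    tsum_succ_dim _ ((headPart_bound ha hc).summable_binw ha _)]
  refine tsum_congr fun y => ?_
  simp only [pot_zero_scons, binw_scons]
  have h := tsum_tail_mul_choose ha (fib_bound ha hc y) (tsum_fib ha hc y) b
  calc ∑' x, tail (fib c y) x * (((Ring.choose x b : ℤ) : ℂ) * binw β y)
      = (∑' x, tail (fib c y) x * ((Ring.choose x b : ℤ) : ℂ)) * binw β y := by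
        rw [← tsum_mul_right]; exact tsum_congr fun x => by ring
    _ = (∑' x, fib c y x * ((Ring.choose x (b + 1) : ℤ) : ℂ)) * binw β y := by rw [h]
    _ = ∑' x, headPart c (scons x y) * (((Ring.choose x (b + 1) : ℤ) : ℂ) * binw β y) := by
        rw [← tsum_mul_right]; exact tsum_congr fun x => by simp only [fib]; ring

/-- Moment transport in directions `≥ 1`: reduces to the marginal in dimension `d − 1`. [folklore] -/
theorem moment_pot_succ {a M : ℝ} {c : Pt (d + 1) → ℂ} (ha : 0 < a) (hc : ExpBound a M c)
    (μ : Fin d) (b : ℕ) (β : Fin d → ℕ) :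
    moment (pot (d + 1) c μ.succ) (scons b β) =
      ((Ring.choose (0 : ℤ) b : ℤ) : ℂ) * moment (pot d (marg c) μ) β := by
  unfold moment
  rw [tsum_succ_dim _ ((pot_bound ha (d + 1) hc μ.succ).summable_binw ha _), ← tsum_mul_left]
  refine tsum_congr fun y => ?_
  simp only [pot_succ_scons, binw_scons]
  rw [tsum_eq_single 0 (fun x hx => by simp [hx])]
  simp; ring

/-- **Moment transport.** If the moments of order `< k+1` of `c` vanish, the moments of order `< k` of every `pot d
c μ` vanish. [cite: GawedzkiKupiainenMasslessLattice1985, App. 2, (6) p. 249 / (13) p. 250 ("the lower order terms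
(l<k) must vanish")] -/
theorem momentsVanish_pot {a : ℝ} (ha : 0 < a) {k : ℕ} :
    ∀ (d : ℕ) {M : ℝ} {c : Pt d → ℂ}, ExpBound a M c → MomentsVanish (k + 1) c →
      ∀ μ, MomentsVanish k (pot d c μ)
  | 0, _, _, _, _, μ => μ.elim0
  | d + 1, M, c, hc, hm, μ => by
    intro α hα
    obtain ⟨b, β, rfl⟩ := exists_eq_scons α
    rw [deg_scons] at hα
    refine Fin.cases ?_ (fun μ' => ?_) μ
    · rw [moment_pot_zero ha hc]
      exact momentsVanish_headPart ha hc hm _ (by simp; omega)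
    · rw [moment_pot_succ ha hc]
      have ih := momentsVanish_pot ha d (marg_bound ha hc) (momentsVanish_marg ha hc hm) μ' β (by omega)
      rw [ih, mul_zero]

/-! ## §8 Order `k`: iterate -/

/-- `Δ_{μs} = Δ_{μs 0} ∘ Δ_{μs 1} ∘ ⋯ ∘ Δ_{μs (k-1)}` (generating function: multiplication by
`Π_j (z_{μs j} - 1)`).
[cite: GawedzkiKupiainenMasslessLattice1985, App. 2 Lemma p. 248 (Π_j (e^(-ip_μj) − 1)) / (14) p. 250] -/
def deltaIter : (k : ℕ) → (Fin k → Fin d) → (Pt d → ℂ) → Pt d → ℂ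
  | 0, _, g => g
  | k + 1, μs, g => delta (μs 0) (deltaIter k (Fin.tail μs) g)

/-- THE ORDER-`k` POTENTIALS `f_{μ₁…μ_k}` of the printed Lemma, in coefficient form: iterate `pot`.
[cite: GawedzkiKupiainenMasslessLattice1985, App. 2 Lemma p. 248 / (14) p. 250 (the f_(μ₁…μ_k))] -/
def potIter : (k : ℕ) → (Pt d → ℂ) → (Fin k → Fin d) → Pt d → ℂ
  | 0, c, _ => c
  | k + 1, c, μs => potIter k (pot d c (μs 0)) (Fin.tail μs)

/-- Unfolding `deltaIter` along `scons`. [folklore] -/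
@[simp] theorem deltaIter_scons (k : ℕ) (μ : Fin d) (μs : Fin k → Fin d) (g : Pt d → ℂ) :
    deltaIter (k + 1) (scons μ μs) g = delta μ (deltaIter k μs g) := by
  simp [deltaIter]

/-- Unfolding `potIter` along `scons`. [folklore] -/
@[simp] theorem potIter_scons (k : ℕ) (μ : Fin d) (μs : Fin k → Fin d) (c : Pt d → ℂ) :
    potIter (k + 1) c (scons μ μs) = potIter k (pot d c μ) μs := by
  simp [potIter]

/-- Splitting a sum over `Fin (k+1) → Fin d` into the first index and the rest. [folklore] -/
theorem sum_idx_succ {k : ℕ} (F : (Fin (k + 1) → Fin d) → ℂ) :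
    ∑ μs, F μs = ∑ μ : Fin d, ∑ μs : Fin k → Fin d, F (scons μ μs) := by
  rw [← (consEquiv k (X := Fin d)).sum_comp, Fintype.sum_prod_type, Finset.sum_comm]
  rfl

/-- **The periodic Gleason lemma, coefficient form** (G–K CMP 99, Appendix 2, Lemma, pp. 248–250): an
exponentially decaying kernel on `ℤ^d` whose moments of order `< k` vanish is a sum of `k`-fold lattice
differences of kernels decaying AT THE SAME RATE, with constant `K(a,d)^k`:
`c = Σ_{μs : Fin k → Fin d} Δ_{μs} (potIter k c μs)`, `|potIter k c μs (n)| ≤ K(a,d)^k · M · e^{-a|n|₁}`.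
[cite: GawedzkiKupiainenMasslessLattice1985, App. 2 Lemma p. 248; proof (5)–(14) pp. 249–250] -/
theorem gleason_coeff {a : ℝ} (ha : 0 < a) :
    ∀ (k : ℕ) {M : ℝ} (c : Pt d → ℂ), ExpBound a M c → MomentsVanish k c →
      (∀ n, c n = ∑ μs : Fin k → Fin d, deltaIter k μs (potIter k c μs) n) ∧
      ∀ μs : Fin k → Fin d, ExpBound a (K a d ^ k * M) (potIter k c μs)
  | 0, M, c, hc, _ => by
    refine ⟨fun n => ?_, fun μs => ?_⟩
    · simp [deltaIter, potIter]
    · simpa [potIter] using hc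
  | k + 1, M, c, hc, hm => by
    have h0 : ∑' n, c n = 0 := by
      have := hm 0 (by simp)
      simpa [moment] using this
    have hrec := sum_delta_pot ha d hc h0
    have hpot := fun μ => gleason_coeff ha k (pot d c μ) (pot_bound ha d hc μ) (momentsVanish_pot ha d hc hm μ)
    refine ⟨fun n => ?_, fun μs => ?_⟩
    · rw [sum_idx_succ]
      calc c n = ∑ μ, delta μ (pot d c μ) n := (hrec n).symm
        _ = ∑ μ, ∑ μs : Fin k → Fin d, delta μ (deltaIter k μs (potIter k (pot d c μ) μs)) n := by
            refine Finset.sum_congr rfl fun μ _ => ?_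
            rw [← delta_finset_sum]
            simp only [delta]
            rw [(hpot μ).1 (n - unitVec μ), (hpot μ).1 n]
        _ = _ := by simp
    · obtain ⟨μ, μs', rfl⟩ := exists_eq_scons μs
      rw [potIter_scons, show K a d ^ (k + 1) * M = K a d ^ k * (K a d * M) by ring]
      exact (hpot μ).2 μs'

/-! ## §9 The printed multiplicative form: generating functions on the closed poly-annulus

G–K p. 249 (5): "f̃(e^{-ip}) ≡ f(p)", "f̃ is analytic for e^{-a} < |z_j| < e^{a}, j = 1, …, d"; (14):
"f̃(z) = Σ_{(μ_j)} f̃_{μ₁…μ_k}(z) Π_{j=1}^{k} (z_{μ_j} - 1)".  With `c` = the Fourier (Laurent) coefficients of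
`f̃`, `genFun c z = Σ_n c(n) zⁿ` is `f̃`, and `Δ_μ` becomes multiplication by `z_μ - 1`. -/

/-- `zⁿ = Π_j z_j^{n_j}`. [folklore] -/
def zpowv (z : Fin d → ℂ) (n : Pt d) : ℂ := ∏ j, z j ^ (n j)

/-- The generating function (Laurent series) `Σ_n c(n) zⁿ`.
[cite: GawedzkiKupiainenMasslessLattice1985, App. 2 (5) p. 249 (f̃(e^(-ip)) ≡ f(p))] -/
def genFun (c : Pt d → ℂ) (z : Fin d → ℂ) : ℂ := ∑' n, c n * zpowv z n

/-- The closed poly-annulus `e^{-b} ≤ |z_j| ≤ e^{b}` (`= |Im p_j| ≤ b` at `z_j = e^{-ip_j}`).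
[cite: GawedzkiKupiainenMasslessLattice1985, App. 2 (5) p. 249 ("analytic for e^(-a) < |z_j| < e^a") / (9) (closed sub-annuli)] -/
def PolyAnnulus (d : ℕ) (b : ℝ) : Set (Fin d → ℂ) :=
  {z | ∀ j, Real.exp (-b) ≤ ‖z j‖ ∧ ‖z j‖ ≤ Real.exp b}

/-- Points of the poly-annulus have non-zero coordinates. [folklore] -/
theorem norm_pos_of_mem {b : ℝ} {z : Fin d → ℂ} (hz : z ∈ PolyAnnulus d b) (j : Fin d) : 0 < ‖z j‖ :=
  (Real.exp_pos _).trans_le (hz j).1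

/-- Points of the poly-annulus have non-zero coordinates. [folklore] -/
theorem ne_zero_of_mem {b : ℝ} {z : Fin d → ℂ} (hz : z ∈ PolyAnnulus d b) (j : Fin d) : z j ≠ 0 :=
  norm_pos_iff.mp (norm_pos_of_mem hz j)

/-- `r^n ≤ e^(b|n|)` for `e^(-b) ≤ r ≤ e^b`, `n ∈ ℤ`. [folklore] -/
theorem zpow_le_exp {b r : ℝ} (h1 : Real.exp (-b) ≤ r) (h2 : r ≤ Real.exp b) (n : ℤ) :
    r ^ n ≤ Real.exp (b * |(n : ℝ)|) := by
  have hr : 0 < r := (Real.exp_pos _).trans_le h1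
  obtain ⟨m, rfl | rfl⟩ := Int.eq_nat_or_neg n
  · rw [zpow_natCast, Int.cast_natCast, Nat.abs_cast, mul_comm, Real.exp_nat_mul]
    exact pow_le_pow_left₀ hr.le h2 m
  · rw [zpow_neg, zpow_natCast, Int.cast_neg, Int.cast_natCast, abs_neg, Nat.abs_cast, mul_comm,
      Real.exp_nat_mul, ← inv_pow]
    apply pow_le_pow_left₀ (inv_nonneg.mpr hr.le)
    calc r⁻¹ ≤ (Real.exp (-b))⁻¹ := inv_anti₀ (Real.exp_pos _) h1
      _ = Real.exp b := by rw [Real.exp_neg, inv_inv]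

/-- `|zⁿ| ≤ e^(b|n|₁)` on the poly-annulus of width `b`. [folklore] -/
theorem norm_zpowv_le {b : ℝ} {z : Fin d → ℂ} (hz : z ∈ PolyAnnulus d b) (n : Pt d) :
    ‖zpowv z n‖ ≤ Real.exp (b * l1 n) := by
  unfold zpowv l1
  rw [norm_prod, Finset.mul_sum, Real.exp_sum]
  refine Finset.prod_le_prod (fun j _ => norm_nonneg _) fun j _ => ?_
  rw [norm_zpow]
  exact zpow_le_exp (hz j).1 (hz j).2 (n j)

/-- On the poly-annulus of width `b < a` the Laurent series of an `a`-decaying kernel converges absolutely.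
[folklore] -/
theorem ExpBound.norm_mul_zpowv_le {a M : ℝ} {c : Pt d → ℂ} (hc : ExpBound a M c) {b : ℝ} {z : Fin d → ℂ}
    (hz : z ∈ PolyAnnulus d b) (n : Pt d) : ‖c n * zpowv z n‖ ≤ M * wt (a - b) n := by
  rw [norm_mul]
  calc ‖c n‖ * ‖zpowv z n‖ ≤ (M * wt a n) * Real.exp (b * l1 n) :=
        mul_le_mul (hc n) (norm_zpowv_le hz n) (norm_nonneg _) (mul_nonneg hc.nonneg (wt_pos a n).le)
    _ = M * wt (a - b) n := by rw [wt, wt, mul_assoc, ← Real.exp_add]; congr 2; ring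

/-- `Σ_(n ∈ ℤ^d) e^(-a|n|₁)` converges for `a > 0`. [folklore] -/
theorem summable_wt {a : ℝ} (ha : 0 < a) (d : ℕ) : Summable fun n : Pt d => wt a n := by
  simpa using summable_wt_pw ha 0 d

/-- Absolute convergence of the Laurent series on the poly-annulus of width `b < a`. [folklore] -/
theorem ExpBound.summable_mul_zpowv {a M : ℝ} {c : Pt d → ℂ} (hc : ExpBound a M c) {b : ℝ}
    (hab : b < a) {z : Fin d → ℂ} (hz : z ∈ PolyAnnulus d b) : Summable fun n => c n * zpowv z n :=
  Summable.of_norm_bounded ((summable_wt (by linarith) d).mul_left M) (hc.norm_mul_zpowv_le hz)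

/-- `Z_d(b) = Σ_{n ∈ ℤ^d} e^{-b|n|₁}` (`= Z(b)^d`). [folklore] -/
def Zd (b : ℝ) (d : ℕ) : ℝ := ∑' n : Pt d, wt b n

/-- The sup bound on the annulus: `|Σ c(n) zⁿ| ≤ M · Z_d(a - b)` for `|c(n)| ≤ M e^{-a|n|₁}`, `z ∈` the closed
poly-annulus of width `b < a` (the coefficient-side half of the printed `sup_{|Im p| ≤ a₁} ≤ C sup_{|Im p| ≤ a₂}`).
[cite: GawedzkiKupiainenMasslessLattice1985, App. 2 (4) p. 248 / (9) p. 249 (sup bounds on closed sub-tubes)] -/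
theorem ExpBound.norm_genFun_le {a M : ℝ} {c : Pt d → ℂ} (hc : ExpBound a M c) {b : ℝ} (hab : b < a)
    {z : Fin d → ℂ} (hz : z ∈ PolyAnnulus d b) : ‖genFun c z‖ ≤ M * Zd (a - b) d := by
  have hs : Summable fun n : Pt d => M * wt (a - b) n := (summable_wt (by linarith) d).mul_left M
  have hn : Summable fun n => ‖c n * zpowv z n‖ :=
    Summable.of_nonneg_of_le (fun _ => norm_nonneg _) (hc.norm_mul_zpowv_le hz) hs
  calc ‖genFun c z‖ ≤ ∑' n, ‖c n * zpowv z n‖ := norm_tsum_le_tsum_norm hn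
    _ ≤ ∑' n, M * wt (a - b) n := hn.tsum_le_tsum (hc.norm_mul_zpowv_le hz) hs
    _ = M * Zd (a - b) d := by rw [tsum_mul_left, Zd]

/-- `z^(m + e_μ) = z^m · z_μ`. [folklore] -/
theorem zpowv_add_unitVec {b : ℝ} {z : Fin d → ℂ} (hz : z ∈ PolyAnnulus d b) (m : Pt d) (μ : Fin d) :
    zpowv z (m + unitVec μ) = zpowv z m * z μ := by
  unfold zpowv
  have h : ∀ j, z j ^ ((m + unitVec μ) j) = z j ^ (m j) * (if j = μ then z j else 1) := by
    intro j
    simp only [Pi.add_apply, unitVec]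
    split_ifs with hj
    · rw [zpow_add₀ (ne_zero_of_mem hz j), zpow_one]
    · simp
  simp_rw [h]
  rw [Finset.prod_mul_distrib, Finset.prod_ite_eq']
  simp

/-- `|n − e_μ|₁ ≥ |n|₁ − 1`. [folklore] -/
theorem l1_sub_unitVec_ge (n : Pt d) (μ : Fin d) : l1 n - 1 ≤ l1 (n - unitVec μ) := by
  unfold l1
  have h : ∀ j, |(n j : ℝ)| - (if j = μ then 1 else 0) ≤ |((n - unitVec μ) j : ℝ)| := by
    intro j
    simp only [Pi.sub_apply, unitVec]
    split_ifs with hj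
    · push_cast
      have := abs_sub_abs_le_abs_sub (n j : ℝ) 1
      rw [abs_one] at this; linarith
    · simp
  calc ∑ j, |(n j : ℝ)| - 1 = ∑ j, (|(n j : ℝ)| - (if j = μ then 1 else 0)) := by
        rw [Finset.sum_sub_distrib, Finset.sum_ite_eq']; simp
    _ ≤ _ := Finset.sum_le_sum fun j _ => h j

/-- `Δ_μ` preserves the decay rate (constant `× (e^a + 1)`). [folklore] -/
theorem delta_bound {a M : ℝ} (ha : 0 < a) {g : Pt d → ℂ} (hg : ExpBound a M g) (μ : Fin d) :
    ExpBound a (M * (Real.exp a + 1)) (delta μ g) := by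
  intro n
  have h1 : wt a (n - unitVec μ) ≤ Real.exp a * wt a n := by
    rw [wt, wt, ← Real.exp_add]
    exact Real.exp_le_exp.mpr (by nlinarith [l1_sub_unitVec_ge n μ, ha.le])
  calc ‖delta μ g n‖ ≤ ‖g (n - unitVec μ)‖ + ‖g n‖ := norm_sub_le _ _
    _ ≤ M * wt a (n - unitVec μ) + M * wt a n := add_le_add (hg _) (hg _)
    _ ≤ M * (Real.exp a * wt a n) + M * wt a n := by gcongr; exact hg.nonneg
    _ = M * (Real.exp a + 1) * wt a n := by ring

/-- Iterated differences preserve the decay rate (constant `× (e^a + 1)^k`). [folklore] -/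
theorem deltaIter_bound {a M : ℝ} (ha : 0 < a) :
    ∀ (k : ℕ) (μs : Fin k → Fin d) {g : Pt d → ℂ}, ExpBound a M g →
      ExpBound a (M * (Real.exp a + 1) ^ k) (deltaIter k μs g)
  | 0, _, _, hg => by simpa [deltaIter] using hg
  | k + 1, μs, g, hg => by
    have := delta_bound ha (deltaIter_bound ha k (Fin.tail μs) hg) (μs 0)
    simp only [deltaIter]
    refine this.mono (le_of_eq ?_); ring

/-- `Δ_μ` is multiplication by `z_μ - 1` on generating functions.
[cite: GawedzkiKupiainenMasslessLattice1985, App. 2 (5), (14) pp. 249–250] -/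
theorem genFun_delta {a M : ℝ} {g : Pt d → ℂ} (hg : ExpBound a M g) {b : ℝ} (hab : b < a)
    {z : Fin d → ℂ} (hz : z ∈ PolyAnnulus d b) (μ : Fin d) :
    genFun (delta μ g) z = (z μ - 1) * genFun g z := by
  have hs : Summable fun n => g n * zpowv z n := hg.summable_mul_zpowv hab hz
  have hshift : ∑' n, g (n - unitVec μ) * zpowv z n = z μ * genFun g z := by
    rw [← (Equiv.addRight (unitVec μ)).tsum_eq]
    simp only [Equiv.coe_addRight, add_sub_cancel_right, zpowv_add_unitVec hz, genFun, ← tsum_mul_left]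
    exact tsum_congr fun n => by ring
  have hs' : Summable fun n => g (n - unitVec μ) * zpowv z n := by
    rw [← (Equiv.addRight (unitVec μ)).summable_iff]
    refine (hs.mul_right (z μ)).congr fun n => ?_
    simp [zpowv_add_unitVec hz]; ring
  unfold genFun
  simp only [delta, sub_mul]
  rw [hs'.tsum_sub hs, hshift, genFun]; ring

/-- Iterated differences are multiplication by `Π_j (z_(μs j) − 1)` on generating functions. [cite:
GawedzkiKupiainenMasslessLattice1985, App. 2 (14) p. 250] -/
theorem genFun_deltaIter {a M : ℝ} (ha : 0 < a) {b : ℝ} (hab : b < a) {z : Fin d → ℂ}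
    (hz : z ∈ PolyAnnulus d b) :
    ∀ (k : ℕ) (μs : Fin k → Fin d) {g : Pt d → ℂ}, ExpBound a M g →
      genFun (deltaIter k μs g) z = (∏ j, (z (μs j) - 1)) * genFun g z
  | 0, _, _, _ => by simp [deltaIter]
  | k + 1, μs, g, hg => by
    simp only [deltaIter]
    rw [genFun_delta (deltaIter_bound ha k (Fin.tail μs) hg) hab hz, genFun_deltaIter ha hab hz k _ hg,
      Fin.prod_univ_succ]
    simp only [Fin.tail]; ring

/-- **The periodic Gleason lemma, printed (multiplicative) form** (G–K CMP 99 App. 2, Lemma p. 248 and (14)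
p. 250): on the closed poly-annulus `e^{-b} ≤ |z_j| ≤ e^{b}`, `b < a`,
`Σ_n c(n) zⁿ = Σ_{μs} Π_j (z_{μs j} - 1) · Σ_n (potIter k c μs)(n) zⁿ`, each factor series bounded by
`K(a,d)^k · M · Z_d(a-b)`. [cite: GawedzkiKupiainenMasslessLattice1985, App. 2 Lemma p. 248 with (4); (14) p. 250] -/
theorem gleason_genFun {a M : ℝ} (ha : 0 < a) {k : ℕ} {c : Pt d → ℂ} (hc : ExpBound a M c)
    (hm : MomentsVanish k c) {b : ℝ} (hab : b < a) {z : Fin d → ℂ} (hz : z ∈ PolyAnnulus d b) :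
    genFun c z = ∑ μs : Fin k → Fin d, (∏ j, (z (μs j) - 1)) * genFun (potIter k c μs) z ∧
      ∀ μs : Fin k → Fin d, ‖genFun (potIter k c μs) z‖ ≤ K a d ^ k * M * Zd (a - b) d := by
  obtain ⟨hdec, hbd⟩ := gleason_coeff ha k c hc hm
  refine ⟨?_, fun μs => (hbd μs).norm_genFun_le hab hz⟩
  have hsum : ∀ μs : Fin k → Fin d, Summable fun n => deltaIter k μs (potIter k c μs) n * zpowv z n :=
    fun μs => (deltaIter_bound ha k μs (hbd μs)).summable_mul_zpowv hab hz
  calc genFun c z = ∑' n, ∑ μs : Fin k → Fin d, deltaIter k μs (potIter k c μs) n * zpowv z n := by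
        unfold genFun
        refine tsum_congr fun n => ?_
        rw [hdec n, Finset.sum_mul]
    _ = ∑ μs : Fin k → Fin d, genFun (deltaIter k μs (potIter k c μs)) z :=
        Summable.tsum_finsetSum fun μs _ => hsum μs
    _ = _ := Finset.sum_congr rfl fun μs _ => genFun_deltaIter ha hab hz k μs (hbd μs)

/-! ## §10 The hypothesis dictionary: monomial moments ⇒ binomial moments

The printed hypothesis is "∂^l f(0)/∂p_{μ₁}…∂p_{μ_l} = 0 for l = 0, 1, …, k-1"; for `f(p) = Σ_n c(n) e^{-ipn}` with
exponentially decaying `c` this says `Σ_n c(n) n^β = 0` for all `|β| < k` (differentiate under the absolutely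
convergent sum: `∂^β f(0) = (-i)^{|β|} Σ_n c(n) n^β` — a standard fact not formalised here).  The binomials
`binom(x, a)` being polynomials of degree `a`, monomial moments of order `< k` control binomial moments of order
`< k`: -/

/-- `n^β = Π_j n_j^{β_j}`. [folklore] -/
def monom (β : Fin d → ℕ) (n : Pt d) : ℂ := ∏ j, ((n j : ℤ) : ℂ) ^ (β j)

/-- `|n^β| ≤ Π_j (|n_j|+1)^p` when `β_j ≤ p`. [folklore] -/
theorem norm_monom_le (β : Fin d → ℕ) {p : ℕ} (hp : ∀ j, β j ≤ p) (n : Pt d) : ‖monom β n‖ ≤ 1 * pw p n := by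
  rw [one_mul, monom, norm_prod, pw]
  refine Finset.prod_le_prod (fun j _ => norm_nonneg _) fun j _ => ?_
  rw [norm_pow, Complex.norm_intCast]
  calc |(n j : ℝ)| ^ β j ≤ (|(n j : ℝ)| + 1) ^ β j :=
        pow_le_pow_left₀ (abs_nonneg _) (by linarith [abs_nonneg (n j : ℝ)]) _
    _ ≤ (|(n j : ℝ)| + 1) ^ p := pow_le_pow_right₀ (by linarith [abs_nonneg (n j : ℝ)]) (hp j)

/-- `binom(x, a) = (a!)⁻¹ Σ_{i ≤ a} coeffᵢ xⁱ` with the (integer) coefficients of the falling factorial. [folklore] -/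
theorem choose_eq_sum (x : ℤ) (a : ℕ) :
    ((Ring.choose x a : ℤ) : ℂ) =
      ∑ i ∈ Finset.range (a + 1), ((a.factorial : ℂ)⁻¹ * ((descPochhammer ℤ a).coeff i : ℂ)) * (x : ℂ) ^ i := by
  have h1 : ((descPochhammer ℤ a).eval x : ℤ) = a.factorial * Ring.choose x a := by
    rw [Polynomial.eval_eq_smeval, Ring.descPochhammer_eq_factorial_smul_choose, nsmul_eq_mul]
  have h2 : (descPochhammer ℤ a).eval x = ∑ i ∈ Finset.range (a + 1), (descPochhammer ℤ a).coeff i * x ^ i :=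
    Polynomial.eval_eq_sum_range' (by rw [descPochhammer_natDegree]; exact Nat.lt_succ_self a) x
  have hf : (a.factorial : ℂ) ≠ 0 := by exact_mod_cast a.factorial_ne_zero
  have h3 : ((Ring.choose x a : ℤ) : ℂ) = (a.factorial : ℂ)⁻¹ * (((descPochhammer ℤ a).eval x : ℤ) : ℂ) := by
    rw [h1]; push_cast; field_simp
  rw [h3, h2]; push_cast
  rw [Finset.mul_sum]
  exact Finset.sum_congr rfl fun i _ => by ring

/-- Binomial weights are finite combinations of monomials of no larger multi-degree. [folklore] -/
theorem binw_eq_sum_monom (α : Fin d → ℕ) : ∃ q : (Fin d → ℕ) → ℂ, ∀ n : Pt d,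
    binw α n = ∑ β ∈ Fintype.piFinset (fun j => Finset.range (α j + 1)), q β * monom β n := by
  refine ⟨fun β => ∏ j, ((α j).factorial : ℂ)⁻¹ * ((descPochhammer ℤ (α j)).coeff (β j) : ℂ), fun n => ?_⟩
  unfold binw monom
  simp_rw [choose_eq_sum]
  rw [Finset.prod_univ_sum]
  refine Finset.sum_congr rfl fun β _ => ?_
  rw [← Finset.prod_mul_distrib]

/-- **Dictionary.** Vanishing of all monomial moments `Σ_n c(n) n^β`, `|β| < k`, implies `MomentsVanish k c`.
[cite: GawedzkiKupiainenMasslessLattice1985, App. 2 Lemma p. 248 (hypothesis ∂^l f(0)/∂p_μ₁…∂p_μl = 0, l = 0, …, k − 1)] -/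
theorem momentsVanish_of_monomial {a M : ℝ} (ha : 0 < a) {c : Pt d → ℂ} (hc : ExpBound a M c) {k : ℕ}
    (h : ∀ β : Fin d → ℕ, deg β < k → ∑' n, c n * monom β n = 0) : MomentsVanish k c := by
  intro α hα
  obtain ⟨q, hq⟩ := binw_eq_sum_monom α
  unfold moment
  simp_rw [hq, Finset.mul_sum]
  have hs : ∀ β ∈ Fintype.piFinset (fun j => Finset.range (α j + 1)),
      Summable fun n => c n * (q β * monom β n) := by
    intro β hβ
    have hβ' : ∀ j, β j ≤ deg α := fun j => by
      have := Fintype.mem_piFinset.mp hβ j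
      rw [Finset.mem_range] at this
      exact (Nat.lt_succ_iff.mp this).trans (le_deg α j)
    have := (hc.summable_mul ha (norm_monom_le β hβ')).mul_left (q β)
    refine this.congr fun n => by ring
  rw [Summable.tsum_finsetSum hs]
  refine Finset.sum_eq_zero fun β hβ => ?_
  have hdeg : deg β < k := by
    refine lt_of_le_of_lt (Finset.sum_le_sum fun j _ => ?_) hα
    have := Fintype.mem_piFinset.mp hβ j
    rw [Finset.mem_range] at this
    exact Nat.lt_succ_iff.mp this
  have := h β hdeg
  calc ∑' n, c n * (q β * monom β n) = q β * ∑' n, c n * monom β n := by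
        rw [← tsum_mul_left]; exact tsum_congr fun n => by ring
    _ = 0 := by rw [this, mul_zero]

/-! ## §11 Linearity (printed: "f_{μ₁…μ_k} can be taken linearly depending on f")

`c ↦ potIter k c μs` is linear on exponentially decaying kernels (additivity needs the decay for the
rearrangements; homogeneity is unconditional). -/

/-- Sums of exponentially bounded kernels. [folklore] -/
theorem ExpBound.add {a M₁ M₂ : ℝ} {c₁ c₂ : Pt d → ℂ} (h₁ : ExpBound a M₁ c₁) (h₂ : ExpBound a M₂ c₂) :
    ExpBound a (M₁ + M₂) (c₁ + c₂) := fun n =>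
  calc ‖(c₁ + c₂) n‖ ≤ ‖c₁ n‖ + ‖c₂ n‖ := norm_add_le _ _
    _ ≤ M₁ * wt a n + M₂ * wt a n := add_le_add (h₁ n) (h₂ n)
    _ = (M₁ + M₂) * wt a n := by ring

/-- Scalar multiples of exponentially bounded kernels. [folklore] -/
theorem ExpBound.smul {a M : ℝ} {c : Pt d → ℂ} (h : ExpBound a M c) (w : ℂ) :
    ExpBound a (‖w‖ * M) (w • c) := fun n => by
  rw [Pi.smul_apply, smul_eq_mul, norm_mul, mul_assoc]
  exact mul_le_mul_of_nonneg_left (h n) (norm_nonneg _)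

/-- Additivity of tail sums (summable sequences). [folklore] -/
theorem tail_add {T₁ T₂ : ℤ → ℂ} (h₁ : Summable T₁) (h₂ : Summable T₂) (x : ℤ) :
    tail (T₁ + T₂) x = tail T₁ x + tail T₂ x := by
  unfold tail
  rw [← (h₁.indicator _).tsum_add (h₂.indicator _)]
  exact tsum_congr fun y => by simp only [Set.indicator_apply, Pi.add_apply]; split_ifs <;> simp

/-- Homogeneity of tail sums. [folklore] -/
theorem tail_smul (w : ℂ) (T : ℤ → ℂ) (x : ℤ) : tail (w • T) x = w * tail T x := by
  unfold tail
  rw [← tsum_mul_left]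
  exact tsum_congr fun y => by simp only [Set.indicator_apply, Pi.smul_apply, smul_eq_mul]; split_ifs <;> simp

/-- Additivity of the marginal. [folklore] -/
theorem marg_add {a M₁ M₂ : ℝ} {c₁ c₂ : Pt (d + 1) → ℂ} (ha : 0 < a) (h₁ : ExpBound a M₁ c₁)
    (h₂ : ExpBound a M₂ c₂) : marg (c₁ + c₂) = marg c₁ + marg c₂ := by
  funext y
  simp only [marg, Pi.add_apply]
  exact (h₁.summable_scons ha y).tsum_add (h₂.summable_scons ha y)

/-- Homogeneity of the marginal. [folklore] -/
theorem marg_smul (w : ℂ) (c : Pt (d + 1) → ℂ) : marg (w • c) = w • marg c := by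
  funext y
  simp only [marg, Pi.smul_apply, smul_eq_mul]
  exact tsum_mul_left

/-- Additivity of the fibres of `headPart`. [folklore] -/
theorem fib_add {a M₁ M₂ : ℝ} {c₁ c₂ : Pt (d + 1) → ℂ} (ha : 0 < a) (h₁ : ExpBound a M₁ c₁)
    (h₂ : ExpBound a M₂ c₂) (y : Pt d) : fib (c₁ + c₂) y = fib c₁ y + fib c₂ y := by
  funext x
  simp only [fib, headPart, spike_scons, marg_add ha h₁ h₂, Pi.add_apply]
  split_ifs <;> ring

/-- Homogeneity of the fibres of `headPart`. [folklore] -/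
theorem fib_smul (w : ℂ) (c : Pt (d + 1) → ℂ) (y : Pt d) : fib (w • c) y = w • fib c y := by
  funext x
  simp only [fib, headPart, spike_scons, marg_smul, Pi.smul_apply, smul_eq_mul]
  split_ifs <;> ring

/-- Additivity of the order-one potentials (on exponentially bounded kernels). [folklore] -/
theorem pot_add {a : ℝ} (ha : 0 < a) :
    ∀ (d : ℕ) {M₁ M₂ : ℝ} {c₁ c₂ : Pt d → ℂ}, ExpBound a M₁ c₁ → ExpBound a M₂ c₂ →
      ∀ μ, pot d (c₁ + c₂) μ = pot d c₁ μ + pot d c₂ μ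
  | 0, _, _, _, _, _, _, μ => μ.elim0
  | d + 1, M₁, M₂, c₁, c₂, h₁, h₂, μ => by
    funext n
    obtain ⟨x, y, rfl⟩ := exists_eq_scons n
    refine Fin.cases ?_ (fun μ' => ?_) μ
    · rw [Pi.add_apply, pot_zero_scons, pot_zero_scons, pot_zero_scons, fib_add ha h₁ h₂,
        tail_add (summable_fib ha h₁ y) (summable_fib ha h₂ y)]
    · rw [Pi.add_apply, pot_succ_scons, pot_succ_scons, pot_succ_scons, marg_add ha h₁ h₂,
        pot_add ha d (marg_bound ha h₁) (marg_bound ha h₂) μ']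
      split_ifs <;> simp

/-- Homogeneity of the order-one potentials. [folklore] -/
theorem pot_smul (w : ℂ) : ∀ (d : ℕ) (c : Pt d → ℂ) (μ : Fin d), pot d (w • c) μ = w • pot d c μ
  | 0, _, μ => μ.elim0
  | d + 1, c, μ => by
    funext n
    obtain ⟨x, y, rfl⟩ := exists_eq_scons n
    refine Fin.cases ?_ (fun μ' => ?_) μ
    · rw [Pi.smul_apply, pot_zero_scons, pot_zero_scons, fib_smul, tail_smul, smul_eq_mul]
    · rw [Pi.smul_apply, pot_succ_scons, pot_succ_scons, marg_smul, pot_smul w d (marg c) μ']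
      split_ifs <;> simp

/-- Additivity of the order-`k` potentials.
[cite: GawedzkiKupiainenMasslessLattice1985, App. 2 Lemma p. 248 ("f_(μ₁…μ_k) can be taken linearly depending on f")] -/
theorem potIter_add {a : ℝ} (ha : 0 < a) :
    ∀ (k : ℕ) {M₁ M₂ : ℝ} {c₁ c₂ : Pt d → ℂ}, ExpBound a M₁ c₁ → ExpBound a M₂ c₂ →
      ∀ μs, potIter k (c₁ + c₂) μs = potIter k c₁ μs + potIter k c₂ μs
  | 0, _, _, _, _, _, _, _ => by simp [potIter]
  | k + 1, M₁, M₂, c₁, c₂, h₁, h₂, μs => by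
    simp only [potIter]
    rw [pot_add ha d h₁ h₂ (μs 0)]
    exact potIter_add ha k (pot_bound ha d h₁ (μs 0)) (pot_bound ha d h₂ (μs 0)) (Fin.tail μs)

/-- Homogeneity of the order-`k` potentials.
[cite: GawedzkiKupiainenMasslessLattice1985, App. 2 Lemma p. 248 ("f_(μ₁…μ_k) can be taken linearly depending on f")] -/
theorem potIter_smul (w : ℂ) : ∀ (k : ℕ) (c : Pt d → ℂ) (μs : Fin k → Fin d),
    potIter k (w • c) μs = w • potIter k c μs
  | 0, _, _ => by simp [potIter]
  | k + 1, c, μs => by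
    simp only [potIter]
    rw [pot_smul w d c (μs 0)]
    exact potIter_smul w k _ _

end Literature.MathematicalPhysics.QuantumFieldTheory.GawedzkiKupiainen1985.PeriodicGleason
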